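import Literature.MathematicalPhysics.QuantumFieldTheory.Balaban1983to89.B4Lemma21Region
import Literature.MathematicalPhysics.QuantumFieldTheory.Balaban1983to89.B4Cor23Zero

/-!
# [B4] Corollary 2.3 (2.30) at `A ≠ 0`: the `L²` decay of the four pairings `⟨f, G_k(Ω,A)f'⟩`,
# `⟨f, D^η_{A,μ}G_k(Ω,A)f'⟩`, `⟨f, G_k(Ω,A)D^{η*}_{A,ν}f'⟩`, `⟨f, D^η_{A,μ}G_k(Ω,A)D^{η*}_{A,ν}f'⟩` for a (1.7)-regular
# field on an arbitrary finite union of unit blocks — `η`-uniform, with mass, explicit `c₀(a)`, `δ₀(d,a)`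

Source under audit (cell pub-balaban): T. Bałaban, *Regularity and decay of lattice Green's functions*, Commun. Math.
Phys. **89** (1983) 571–597 [cite: Balaban1983RegularityDecay, "B4"], p. 572 [PDF 2] (1.1)–(1.7), p. 573 [PDF 3]
(1.8), p. 580 [PDF 10] (2.29), Remark and Corollary 2.3 (2.30), p. 581 [PDF 11] (end of the Corollary) (journal page =
PDF page + 570; cell transcript `b2b-balaban-b04/transcript-B4.md` l. 8–24, 139–150).  Method: J. M. Combes, L. Thomas,
Commun. Math. Phys. **34** (1973) 251–270 [cite: CombesThomas1973], §II (exponentially conjugated resolvent), in the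
quadratic-form version of this lineage (`B4Cor23Zero`, the `A = 0` sibling, whose site weight `ctw` and three
elementary lemmas are USED; `B4Lemma21Region`, node 4 of the `A ≠ 0` chain, whose region operator `regionOp`, covariant
derivative `covDeriv`/`regionDeriv`, coercivity `regionOp_form_ge` = (1.8) and Dirichlet bound `regionDeriv_sq_le_form`
= (2.29) are USED; no existing module is touched).

## WHAT IS PRINTED (verbatim, from the cell transcript; `≦` of the print written `≤`)

p. 572 [PDF 2]: *"We consider subsets Ω which are unions of big blocks."*; (1.2) *"U(A) = e^{qeηA}"*, *"q is an
antisymmetric N×N matrix, where e is a real parameter."*; (1.3) *"⟨φ, (−Δ^{η,N}_{A,Ω})φ⟩ = Σ_{b⊂Ω} η^d |(D^η_Aφ)(b)|²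
= Σ_{b⊂Ω} η^d |η^{−1}(U(A_b)φ(b₊) − φ(b₋))|², φ : Ω → R^N"*, *"summation is over the set of all bonds b = ⟨b₋,b₊⟩
with end-points b₋, b₊ in Ω"*; (1.4) *"(Q_k(A)φ)(y) = Σ_{x∈B^k(y)} η^d U(A(Γ^{(k)}_{y,x})) φ(x), y ∈ Z^d"*; (1.5)
*"P_k(A) = Q_k^*(A) Q_k(A)"*; (1.6) *"G_k(Ω, A) = (−Δ^{η,N}_{A,Ω} + m² + aP_k(A))^{−1}"*, *"where m² ≥ 0 and a is a
positive constant close to 1."*; (1.7) *"|(∂^η_μ A)(x)| ≤ c e^{β−1}, x ∈ Ω, μ = 1,…,d, β > 0"* (*"the vector field A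
is regular on Ω in the sense that"*), p. 573 [PDF 3]: *"and c is some universal constant."*; *"there exists a positive
constant γ₀ such that for e sufficiently small and for a regular vector field A  −Δ^{η,N}_{A,Ω} + aP_k(A) ≥ γ₀ I. (1.8)
The constant γ₀ is independent of the lattice spacing η, as well as of Ω and of A."*

p. 580 [PDF 10], end of the proof of Lemma 2.1: (2.29) *"‖∂^η_μG_k^{1/2}(□,0)f‖₂² = ⟨f, G_k^{1/2}(□,0)∂^{η*}_μ∂^η_μ
G_k^{1/2}(□,0)f⟩ ≤ ⟨f, G_k^{1/2}(□,0)(−Δ^{η,N}_□ + m_k² + a_kP_k)G_k^{1/2}(□,0)f⟩ = ‖f‖₂²"*, *"hence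
‖∂^η_μG_k^{1/2}(□,0)‖_{2,2} = ‖G_k^{1/2}(□,0)∂^{η*}_μ‖_{2,2} ≤ 1"*.  Then: *"Remark. Let us notice that this lemma alone
implies a weaker version of Proposition I.2.1 with L²-norms. More exactly we have*
**Corollary 2.3.** *If Ω and A are as in Proposition I.2.1, then there exist positive constants c₀, δ₀ such that for
arbitrary scalar field configurations f, f' defined on Ω, we have
|⟨f, G_k(Ω,A)f'⟩|, |⟨f, D^η_{A,μ}G_k(Ω,A)f'⟩|, |⟨f, G_k(Ω,A)D^{η*}_{A,ν}f'⟩|, |⟨f, D^η_{A,μ}G_k(Ω,A)D^{η*}_{A,ν}f'⟩|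
≤ c₀e^{−δ₀dist(supp f, supp f')}‖f‖₂‖f'‖₂."* (2.30)   p. 581 [PDF 11]: *"The same inequalities hold for δG_k(Ω,Ω₀,A)
with the additional factor e^{−δ₀(dist(supp f,Ω^c) + dist(supp f',Ω^c))}. Of course it is enough to prove it for f, f'
with supports in unit cubes, and the proof proceeds as before using only the L²-bounds of Lemma 2.1. Let us notice also
that now there are no restrictions on supports of f, f', so in this aspect the Corollary is a little bit stronger than
Proposition I.2.1."*  («Ω and A are as in Proposition I.2.1» = the Theorem of p. 573: Ω a union of big blocks, A regular
(1.7), e sufficiently small.)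

## WHAT THIS FILE CERTIFIES (sorry-free; axioms `propext`, `Classical.choice`, `Quot.sound`; the lineage is USED)

Setting = that of `B4Lemma21Region` (node 4), LATTICE UNITS and COUNTING BASES: dimension `d + 1 =: D` (the paper's
`d`), mesh `η = 1/n` (ANY `n ≥ 1`), the region `□ = Ω` ↔ `fineDom n Ωc` (the fine points over an ARBITRARY finite set
`Ωc` of unit labels), `R^N`-valued configurations `f : ↥(fineDom n Ωc) × ι → ℝ` (`N = |ι|`), link matrices
`U(eηA_b) = F.U((e/n)·A_b)` for an orthogonal flow `F` with `|(U(t) − 1)v| ≤ ℓ|t||v|`, the vector field in component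
form `Ac x ν = A_ν(x)`; `H = −Δ^{η,N}_{A,Ω} + m² + aP_k(A)` ↔ `regionOp F e hn a m2 Ωc Ac`, `G_k(Ω,A) = H⁻¹`,
`D^η_{A,μ}` ↔ `regionDeriv F e n Ωc Ac μ` (`= covDeriv`), `D^{η*}_{A,ν}` ↔ its transpose; `⟨f,g⟩` ↔ `f ⬝ᵥ g`,
`‖f‖₂` ↔ `bl2n f = (f ⬝ᵥ f)^{1/2}`, `supp f` ↔ `bsupp f` (sites where the `R^N`-value is non-zero),
`dist(supp f, supp f')` ↔ `bsuppDist` (`η`-scaled sup-distance `B4Lower18.edistR`).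

* (§A) the CONJUGATION ERROR `cerr H φ w = Σ_{j,k}(e^{φ(j₁)−φ(k₁)} − 1)H_{jk}w_jw_k` of a block matrix under a SITE
  weight (`cerr_eq`: `= ⟨e^{φ}w, He^{−φ}w⟩ − ⟨w,Hw⟩`), and its lower bounds for the three summands of `b4Op`/`covOp`:
  the covariant Laplacian with ORTHOGONAL links (`cerr_covLap_ge`: `≥ −Λ‖w‖²` whenever `Σ_y (c_xy + c_yx)(e^{φx−φy} +
  e^{φy−φx} − 2) ≤ 2Λ` — the links drop out: `|⟨W_{xy}w_y, w_x⟩| ≤ (|w_x|² + |w_y|²)/2` for `W_{xy}ᵀW_{xy} = 1`), the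
  projection part `a·Σ_b (Σ_x q_b(x)T_{bx}w_x)²` with ORTHOGONAL transporters (`cerr_projOp_ge`: `≥ −(e^θ − 1)M‖w‖²`
  when `φ` moves by `≤ θ` on each block and `Σ_b|q_b(x)|Σ_y|q_b(y)| ≤ M`), the diagonal mass (error `0`):
  `cerr_covOp_ge`.  THE GAUGE FIELD COSTS NOTHING: the bounds are those of `A = 0`.
* (§B, `cerr_regionOp_ge`) for [B4]'s region operator and any site weight with `|φ(x) − φ(y)| ≤ δ·dist_η(x,y)`,
  `0 ≤ δ ≤ 1`: `cerr ≥ −(2(d+1)δ² + a(e^δ − 1))‖w‖²` for EVERY `A`, every mesh, every `Ωc` (fine bonds: coupling `n²`,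
  weight step `≤ δ/n`, `e^t + e^{−t} − 2 ≤ 2t²` for `|t| ≤ 1`, `≤ 2(d+1)` neighbours; blocks: diameter `< 1` in
  `η`-units, `Σ_b|q_b(x)|Σ_y|q_b(y)| ≤ n^{d+1}` against `a_k = a·n^{−(d+1)}`).
* (§C) the COVARIANT WEIGHTED LEIBNIZ RULE `covLeibniz_sq_le`: `|D^η_{W,μ}(e^{ψ}w)(x)|² ≤ 2e^{2ψ(x)}(|D^η_{W,μ}w(x)|² +
  4δ²|w(x+e_μ)|²)` when `ψ` moves by `≤ δ/n ≤ 1/n` across the bond (`n|e^{s} − 1| ≤ 2δ` for `|s| ≤ δ/n`; the link is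
  orthogonal so `|W w(x+e_μ)| = |w(x+e_μ)|`); `dot_transpose_mulVec` (`⟨u, D^⊤f'⟩ = ⟨Du, f'⟩`).
* (§D) under the bundled hypotheses `CTHyp n R H W σ δ` (coercivity `σ‖Φ‖² ≤ ⟨Φ,HΦ⟩`, `‖D^η_{W,μ}Φ‖² ≤ ⟨Φ,HΦ⟩` for all
  `μ`, orthogonal links, `0 ≤ δ ≤ 1`, conjugation error `≥ −(σ/2)‖w‖²` for every weight `δ·dist_η(·,T)`): the two
  ENERGY BOUNDS `⟨w,Hw⟩ ≤ (4/σ)‖g‖²` for `w = e^{φ}Gg`, `supp g ⊆ T` (`energyA`) and `⟨w,Hw⟩ ≤ 8(1 + 4δ²/σ)‖f'‖²` for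
  `w = e^{φ}GD_ν^⊤f'`, `supp f' ⊆ T` (`energyB` — through the pairing `⟨D_ν(e^{φ}w), f'⟩`, never through
  `‖D^⊤f'‖ ∼ n‖f'‖`), the EXTRACTION LEMMAS on a set `S` with `dist_η(S,T) ≥ ρ` (`setSq_le_energy`,
  `setDSq_le_energy`) and the FOUR SET-TO-SET DECAY ESTIMATES `green_setDecay`, `dgreen_setDecay`, `greenT_setDecay`,
  `dgreenT_setDecay`: `Σ_{x∈S}|(Xf')(x)|² ≤ K·e^{−2δρ}·‖f'‖²`, `X ∈ {G, D_μG, GD_ν^⊤, D_μGD_ν^⊤}`,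
  `K ∈ {(2/σ)², (8/σ)(1+4δ²/σ) (twice), 16(1+4δ²/σ)²}`.
* (§E, `pairings_set`) the FOUR PAIRINGS, abstract step: `|⟨f, Xf'⟩| ≤ c(σ)e^{−δρ}‖f‖₂‖f'‖₂` for `supp f ⊆ S × R^N`,
  `supp f' ⊆ T × R^N`, `dist_η(S,T) ≥ ρ`, ONE constant `c(σ) = 4(1 + 4/σ)(1 + 1/σ)` (`cR`, `consts_le_cR_sq`,
  Cauchy–Schwarz `abs_dot_le_of_setSq`).
* (§F) **(2.30) FOR `G_k(Ω,A)` AT `A ≠ 0`**: `ctHyp_region` — the hypotheses of §D HOLD for `regionOp` with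
  `σ = min(2,a)/4` under node 4's printed hypotheses ((1.7) in lattice units `|A_ν(x+e_μ) − A_ν(x)| ≤ ce^{β−1}/n` on
  `Ω`, and the smallness `ℓ²((d+1)ce^β)²(d+1)(1+a(d+1)) ≤ min(2,a)/4` ⇐ `e ≤ e₁`); `delta0R_admissible` — the explicit
  `δ₀(d,a) = min(2,a)/(16(d+1+a))` satisfies `2(d+1)δ₀² + a(e^{δ₀} − 1) ≤ min(2,a)/8` (`e^δ − 1 ≤ δ + δ²`, Mathlib's
  `Real.abs_exp_sub_one_sub_id_le`); `cor23_pairings_set_region` (set form, any admissible `δ`);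
  **`cor23_main_region`**: for every mesh, every finite union `Ω` of unit blocks, every (1.7)-regular `A` with `e`
  small, every `m² ≥ 0`, all `R^N`-valued `f, f'` and all `μ, ν`, the four inequalities (2.30) with
  `c₀(a) = 4(1 + 16/min(2,a))(1 + 4/min(2,a))` (`c0R_eq`) and `δ₀(d,a)`; **`cor23_region_exists`**: the PRINTED
  QUANTIFIER SHAPE «there exist positive constants c₀, δ₀» (and the threshold `e₁` of «e sufficiently small»,
  `B4Lower18Regular.threshold_exists`) BEFORE the instance `(e, η, Ω, A, m², f, f', μ, ν)`; `cor23_region_exists_rot`: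
  the hypothesis-free instance for the rotation flow (`N = 2`, `ℓ = 1`); a numerical instance (`a = 1`, `d + 1 = 4`:
  `c₀ = 340`, `δ₀ = 1/80`) is the closing `example`.

Mechanism (for the referee).  The paper proves the Corollary by re-running the random-walk expansion (2.13) of §2
with the `L²` bounds of Lemma 2.1 in place of the `L^∞` ones.  Here a ONE-STEP Combes–Thomas estimate in quadratic-form
language gives (2.30) directly, uniformly in `η`, AT `A ≠ 0`: conjugate `H` by the SITE weight `e^{φ}`,
`φ = δ·dist_η(·, supp f')`.  Because `e^{φ}` is a scalar at each site it commutes with the link matrices `U(eηA_b)` and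
with the contour transporters `U(A(Γ^{(k)}_{y,x}))`, and because these are ORTHOGONAL the Cauchy–Schwarz steps of the
`A = 0` argument go through verbatim: the conjugation error of `H` is `≥ −(2(d+1)δ² + a(e^δ − 1))‖w‖²` for every `A`.
Coercivity is where `A ≠ 0` enters: (1.8) on the region, `H ≥ min(2,a)/4 + m²` under (1.7) and small `e` (node 4, from
nodes 1–3 of the chain: gauge covariance, the constant-field box bound, the regular-field perturbation), absorbs the
error when `2(d+1)δ² + a(e^δ − 1) ≤ min(2,a)/8`.  The energy `E = ⟨w,Hw⟩` of the conjugated solution then obeys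
`E ≤ 2P`, `P² ≤ K·E` with `P` the conjugated pairing with the source; for the source `D_ν^⊤f'` one moves `D_ν` onto
`e^{φ}w` by the covariant weighted Leibniz rule and uses (2.29) in the form `‖D^η_{A,ν}w‖² ≤ E`, which keeps the bound
`η`-uniform although `‖D^{η*}f'‖₂ ∼ η^{−1}‖f'‖₂`.  Values and covariant `η`-differences of `e^{−φ}w` on `supp f` are
then `e^{−δρ}`-small in `ℓ²`, and Cauchy–Schwarz against `f` gives the four pairings with one constant `c(min(2,a)/4)`.

## DICTIONARY (folklore; each line is used only through the kernel-checked identities named)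

* All of `B4Lemma21Region`'s DICTIONARY (lattice units, `fineDom`, `compField`, `regionOp` = the `b4Op` of
  `B4GaugeCovariance` with the (1.3) weights `regWt`, `a_k = a·n^{−(d+1)}` and the block data of
  `B4Lower18RegularRegion`, `covDeriv`/`regionDeriv` = `D^η_{A,μ}` with Neumann convention, `D^{η*}` = transpose, the
  invertibility of `H` by coercivity).  Big blocks are unions of unit blocks, so the paper's regions are among ours.
* «scalar field configurations f, f' defined on Ω» = the `φ : Ω → R^N` of (1.3) (scalar = matter field, as opposed to the
  vector = gauge field `A`) ↔ `f : ↥(fineDom n Ωc) × ι → ℝ`; a function on `μ`-bonds `⟨x, x+ηe_μ⟩ ⊂ Ω` ↔ a function of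
  the site `x`, `0` at the sites whose `μ`-bond leaves `Ω` (so `⟨f, D_μGf'⟩` pairs `f` with a bond function, as printed).
* inner products: the paper's `⟨f,g⟩ = Σ_x η^D f(x)·g(x)`, `‖f‖₂ = ⟨f,f⟩^{1/2}`; ours are the counting ones
  (`f ⬝ᵥ g = Σ_x Σ_i f(x,i)g(x,i)`, `bl2n`).  The operator of (1.6) has the SAME matrix in both normalisations (its form
  (1.3) + `m²‖φ‖₂² + a‖Q_k(A)φ‖²` carries the common factor `η^D`; `B4Lower18`/`B4GaugeCovariance`, DICTIONARY), so
  `G_k(Ω,A) = H⁻¹` and `D^η_{A,μ}` are the same matrices, `D^{η*}_{A,ν}` (the adjoint for the weight `η^D` on sites and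
  bonds alike) is the transpose, and both sides of (2.30) scale by the same `η^D`: (2.30) in the paper's normalisation is
  literally `cor23_main_region`.
* `dist(supp f, supp f')` ↔ `bsuppDist n R f f'` = the minimum over `supp f × supp f'` of the `η`-scaled SUP-norm
  distance `edistR` (`= 0` if a support is empty, when both sides vanish anyway); for the Euclidean distance the statement
  holds with `δ₀/√D` in place of `δ₀` (`‖·‖_∞ ≥ ‖·‖₂/√D`), not spelled out.
* `U(t) = e^{tq}`, `q` antisymmetric ↔ an orthogonal flow `F : OrthFlow ι` with the Lipschitz bound `|(U(t)−1)v| ≤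
  ℓ|t||v|` (`ℓ = ‖q‖`; `ℓ = 1` for the rotation flow `OrthFlow.rot`, `N = 2`, `B4Lower18Regular.rot_lipschitz`).

## HONEST SCOPE

* ONLY the `G_k(Ω,A)` clause (2.30) of the Corollary is certified.  The `δG_k(Ω,Ω₀,A)` clause (p. 581, the extra
  factor `e^{−δ₀(dist(supp f,Ω^c) + dist(supp f',Ω^c))}`) is NOT here; consequently the typed carrier statement
  `B4.Cor23Printed` (which conjoins both clauses) is NOT discharged by this file.  Nor are: the variant for
  `G_k(Ω,Λ,A)` of (3.5) (p. 588, «with only slight changes», census G-B4-04), the torus setting of p. 572, Lemma 2.2 /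
  the Hölder norms (2.14), or anything of §§3–5.
* HYPOTHESES = exactly node 4's typing of «Ω and A are as in Proposition I.2.1 … e sufficiently small»: (1.7) in lattice
  units on `Ω` with constants `c ≥ 0`, `β > 0`; the smallness inequality on `e` (⇐ `0 < e ≤ e₁(ℓ,(d+1)c,a,β,d)`,
  `threshold_exists`); `a > 0` ANY (the paper: «close to 1»), `m² ≥ 0` ANY; the flow's Lipschitz constant `ℓ`.  The
  coercivity VALUE `min(2,a)/4` is the lineage's (1.8) witness (the paper's `γ₀` is unspecified), hence so are the
  VALUES `c₀(a)`, `δ₀(d,a)` (the paper's are unspecified «positive constants»); they depend on `a` (and `δ₀` on `d`)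
  only — not on `η`, `Ω`, `A`, `m²`, `e`, `N`, as (2.30) requires.
* The ROUTE differs from the printed proof sketch («the proof proceeds as before using only the L²-bounds of Lemma
  2.1», i.e. the expansion (2.13)); what is certified is the printed STATEMENT (2.30) for `G_k(Ω,A)` under the printed
  hypotheses as typed by the lineage, by a one-step Combes–Thomas estimate [cite: CombesThomas1973, §II].  No step of
  the manuscript under audit is used as a hypothesis.
* Value = kernel certificate of a published (1983), undisputed, lemma-level statement of [B4] under the lineage's typed
  hypotheses — bookkeeping for the cell's audit of [B4] §2, NOT summit progress (no statement about the continuum /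
  infinite-volume limit, the mass gap, or `Summit.QuantumFields` is made or approached).

v1.2 (DOCFIX, 2026-08-19, self-audit of every «» unit against transcript-B4.md; the XREADs of this module were clean):
glyph-level normalisation inside quotation units only (prime `f'` as printed, `e^{…}` as printed, «Ω and A are as in
Proposition I.2.1» with its verb); no Lean statement or proof changed.
-/

namespace Literature.MathematicalPhysics.QuantumFieldTheory.Balaban1983to89.B4Cor23Region

open Matrix Finset
open Literature.MathematicalPhysics.QuantumFieldTheory.Balaban1983to89.B4GaugeCovariance
open Literature.MathematicalPhysics.QuantumFieldTheory.Balaban1983to89.B4Lower18Regular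
  (orth_dotProduct_mulVec_self dotProduct_eq_sum_fld transport_fieldLink e1 dotProduct_self_nonneg')

noncomputable section

/-! ## §A  The conjugation error of a block operator under a site weight -/

section ConjError

variable {X Y ι : Type*}

/-- the site-weighted field `(e^{ψ}w)(x) = e^{ψ(x)} w(x)`. [folklore] -/
def wexp (ψ : X → ℝ) (w : X × ι → ℝ) : X × ι → ℝ := fun j => Real.exp (ψ j.1) * w j

/-- entries of the weighted field. [folklore] -/
@[simp] theorem wexp_apply (ψ : X → ℝ) (w : X × ι → ℝ) (j : X × ι) : wexp ψ w j = Real.exp (ψ j.1) * w j := rfl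

/-- the weighted field sitewise: `(e^{ψ}w)(x) = e^{ψ(x)}·w(x)`. [folklore] -/
theorem fld_wexp (ψ : X → ℝ) (w : X × ι → ℝ) (x : X) : fld (wexp ψ w) x = Real.exp (ψ x) • fld w x := by
  funext i; simp [fld, wexp]

variable [Fintype X] [Fintype Y] [Fintype ι]

/-- **THE CONJUGATION ERROR** of a real matrix `H` on `X × ι` for a SITE weight `φ`:
`Σ_{j,k} (e^{φ(j₁) − φ(k₁)} − 1) H_{jk} w_j w_k`. [cite: CombesThomas1973, §II] [folklore] -/
def cerr (H : Matrix (X × ι) (X × ι) ℝ) (φ : X → ℝ) (w : X × ι → ℝ) : ℝ :=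
  ∑ j, ∑ k, (Real.exp (φ j.1 - φ k.1) - 1) * H j k * (w j * w k)

/-- the conjugation error as a difference of two pairings: `⟨e^{φ}w, H e^{−φ}w⟩ − ⟨w, Hw⟩`. [folklore] -/
theorem cerr_eq (H : Matrix (X × ι) (X × ι) ℝ) (φ : X → ℝ) (w : X × ι → ℝ) :
    cerr H φ w = wexp φ w ⬝ᵥ (H *ᵥ wexp (fun x => -φ x) w) - w ⬝ᵥ (H *ᵥ w) := by
  simp only [cerr, dotProduct, mulVec, wexp_apply, Finset.mul_sum, ← Finset.sum_sub_distrib]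
  refine Finset.sum_congr rfl fun j _ => Finset.sum_congr rfl fun k _ => ?_
  rw [Real.exp_sub, Real.exp_neg, div_eq_mul_inv]
  ring

/-- the conjugation error is additive in the operator. [folklore] -/
theorem cerr_add (H₁ H₂ : Matrix (X × ι) (X × ι) ℝ) (φ : X → ℝ) (w : X × ι → ℝ) :
    cerr (H₁ + H₂) φ w = cerr H₁ φ w + cerr H₂ φ w := by
  simp only [cerr, Matrix.add_apply, ← Finset.sum_add_distrib]
  refine Finset.sum_congr rfl fun j _ => Finset.sum_congr rfl fun k _ => ?_
  ring

/-- the conjugation error is homogeneous in the operator. [folklore] -/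
theorem cerr_smul (r : ℝ) (H : Matrix (X × ι) (X × ι) ℝ) (φ : X → ℝ) (w : X × ι → ℝ) :
    cerr (r • H) φ w = r * cerr H φ w := by
  simp only [cerr, Matrix.smul_apply, smul_eq_mul, Finset.mul_sum]
  refine Finset.sum_congr rfl fun j _ => Finset.sum_congr rfl fun k _ => ?_
  ring

/-- a SITE-DIAGONAL operator (e.g. the mass term) has no conjugation error. [folklore] -/
theorem cerr_one [DecidableEq X] [DecidableEq ι] (φ : X → ℝ) (w : X × ι → ℝ) :
    cerr (1 : Matrix (X × ι) (X × ι) ℝ) φ w = 0 := by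
  simp only [cerr]
  refine Finset.sum_eq_zero fun j _ => Finset.sum_eq_zero fun k _ => ?_
  by_cases hjk : j = k
  · subst hjk; simp
  · simp [hjk]

/-- **THE BILINEAR FORM OF THE COVARIANT LAPLACIAN**: `⟨Ψ, (−Δ_W)Φ⟩ = Σ_{x,y} c(x,y)·⟨W(x,y)ψ(y) − ψ(x), W(x,y)φ(y) − φ(x)⟩`
(polarisation of (1.3)). [cite: Balaban1983RegularityDecay, p. 572 (1.3)] [folklore] -/
theorem covLap_biform [DecidableEq X] [DecidableEq ι] (c : X → X → ℝ) (W : X → X → Matrix ι ι ℝ)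
    (Ψ Φ : X × ι → ℝ) :
    Ψ ⬝ᵥ (covLap c W *ᵥ Φ)
      = ∑ x, ∑ y, c x y * ((W x y *ᵥ fld Ψ y - fld Ψ x) ⬝ᵥ (W x y *ᵥ fld Φ y - fld Φ x)) := by
  have hterm : ∀ x y, Ψ ⬝ᵥ ((c x y • ((bondDiff W x y)ᵀ * bondDiff W x y)) *ᵥ Φ)
      = c x y * ((W x y *ᵥ fld Ψ y - fld Ψ x) ⬝ᵥ (W x y *ᵥ fld Φ y - fld Φ x)) := by
    intro x y
    rw [Matrix.smul_mulVec, dotProduct_smul, smul_eq_mul, ← Matrix.mulVec_mulVec,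
      Matrix.dotProduct_mulVec, Matrix.vecMul_transpose]
    congr 1
    rw [dotProduct, Fintype.sum_prod_type, Finset.sum_eq_single ()]
    · have hΨ : ∀ i, (bondDiff W x y *ᵥ Ψ) ((), i) = (W x y *ᵥ fld Ψ y - fld Ψ x) i :=
        fun i => congrFun (fld_bondDiff_mulVec W x y Ψ ()) i
      have hΦ : ∀ i, (bondDiff W x y *ᵥ Φ) ((), i) = (W x y *ᵥ fld Φ y - fld Φ x) i :=
        fun i => congrFun (fld_bondDiff_mulVec W x y Φ ()) i
      simp_rw [hΨ, hΦ]
      rfl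
    · intro u _ hu; exact absurd (Subsingleton.elim u ()) hu
    · intro h; exact absurd (Finset.mem_univ ()) h
  simp only [covLap, Matrix.sum_mulVec, dotProduct_sum, hterm]

/-- the bilinear form of `P = Q^*Q`: `⟨Ψ, PΦ⟩ = ⟨QΨ, QΦ⟩`. [cite: Balaban1983RegularityDecay, p. 572 (1.5)] [folklore] -/
theorem projOp_biform (q : Y → X → ℝ) (T : Y → X → Matrix ι ι ℝ) (Ψ Φ : X × ι → ℝ) :
    Ψ ⬝ᵥ (projOp q T *ᵥ Φ) = (avgOp q T *ᵥ Ψ) ⬝ᵥ (avgOp q T *ᵥ Φ) := by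
  rw [projOp, ← Matrix.mulVec_mulVec, Matrix.dotProduct_mulVec, Matrix.vecMul_transpose]


/-- `e^{t} + e^{−t} − 2 ≥ 0`. [folklore] -/
theorem exp_add_exp_neg_sub_two_nonneg (t : ℝ) : 0 ≤ Real.exp t + Real.exp (-t) - 2 := by
  have h1 := Real.add_one_le_exp t
  have h2 := Real.add_one_le_exp (-t)
  linarith

/-- `2⟨p, q⟩ ≤ |p|² + |q|²`. [folklore] -/
theorem two_mul_dotProduct_le (p q : ι → ℝ) : 2 * (p ⬝ᵥ q) ≤ p ⬝ᵥ p + q ⬝ᵥ q := by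
  have h : 0 ≤ (p - q) ⬝ᵥ (p - q) := by
    simp only [dotProduct]; exact Finset.sum_nonneg fun i _ => mul_self_nonneg _
  simp only [sub_dotProduct, dotProduct_sub, dotProduct_comm q p] at h
  linarith

/-- `2|⟨p, q⟩| ≤ |p|² + |q|²`. [folklore] -/
theorem two_mul_abs_dotProduct_le (p q : ι → ℝ) : 2 * |p ⬝ᵥ q| ≤ p ⬝ᵥ p + q ⬝ᵥ q := by
  have h1 := two_mul_dotProduct_le p q
  have h2 := two_mul_dotProduct_le p (-q)
  simp only [dotProduct_neg, neg_dotProduct, neg_neg] at h2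
  have h3 : |p ⬝ᵥ q| ≤ (p ⬝ᵥ p + q ⬝ᵥ q) / 2 := abs_le.2 ⟨by linarith, by linarith⟩
  linarith

omit [Fintype X] in
/-- the per-bond conjugation identity of the covariant Laplacian: with `u = e^{φ}w`, `v = e^{−φ}w`,
`⟨Wu(y) − u(x), Wv(y) − v(x)⟩ − |Ww(y) − w(x)|² = −(e^{φ(x)−φ(y)} + e^{φ(y)−φ(x)} − 2)·⟨w(x), Ww(y)⟩` — the odd
(`sinh`) part of the conjugated coefficient cancels in the quadratic form. [cite: CombesThomas1973, §II] [folklore] -/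
theorem bond_conj_identity (Wm : Matrix ι ι ℝ) (φ : X → ℝ) (w : X × ι → ℝ) (x y : X) :
    (Wm *ᵥ fld (wexp φ w) y - fld (wexp φ w) x) ⬝ᵥ
        (Wm *ᵥ fld (wexp (fun z => -φ z) w) y - fld (wexp (fun z => -φ z) w) x)
      - (Wm *ᵥ fld w y - fld w x) ⬝ᵥ (Wm *ᵥ fld w y - fld w x)
      = -((Real.exp (φ x - φ y) + Real.exp (φ y - φ x) - 2) * (fld w x ⬝ᵥ (Wm *ᵥ fld w y))) := by
  have hx : Real.exp (φ x) ≠ 0 := (Real.exp_pos _).ne'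
  have hy : Real.exp (φ y) ≠ 0 := (Real.exp_pos _).ne'
  simp only [fld_wexp, Matrix.mulVec_smul, sub_dotProduct, dotProduct_sub, smul_dotProduct, dotProduct_smul,
    smul_eq_mul, Real.exp_sub, Real.exp_neg, dotProduct_comm (Wm *ᵥ fld w y) (fld w x)]
  field_simp
  ring

/-- **CONJUGATION ERROR OF THE COVARIANT LAPLACIAN WITH ORTHOGONAL LINK VARIABLES** (bond weights `c ≥ 0` on ordered
pairs, `W(x,y)` orthogonal): if `Σ_y (c(x,y) + c(y,x))(e^{φ(x)−φ(y)} + e^{φ(y)−φ(x)} − 2) ≤ 2Λ` for every site `x`, then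
`−Λ‖w‖² ≤ Σ_{j,k} (e^{φ_j − φ_k} − 1)(−Δ_W)_{jk} w_j w_k` — exactly the scalar Combes–Thomas bound: the link variables
drop out because `|W(x,y)w(y)| = |w(y)|`. [cite: CombesThomas1973, §II] [folklore] -/
theorem cerr_covLap_ge [DecidableEq X] [DecidableEq ι] {c : X → X → ℝ} (hc : ∀ x y, 0 ≤ c x y)
    {W : X → X → Matrix ι ι ℝ} (hW : ∀ x y, (W x y)ᵀ * W x y = 1) (φ : X → ℝ) {Λ : ℝ}
    (hΛ : ∀ x, ∑ y, (c x y + c y x) * (Real.exp (φ x - φ y) + Real.exp (φ y - φ x) - 2) ≤ 2 * Λ)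
    (w : X × ι → ℝ) : -Λ * (w ⬝ᵥ w) ≤ cerr (covLap c W) φ w := by
  set g : X → X → ℝ := fun x y => Real.exp (φ x - φ y) + Real.exp (φ y - φ x) - 2 with hg
  set nw : X → ℝ := fun x => fld w x ⬝ᵥ fld w x with hnw
  have hg0 : ∀ x y, 0 ≤ g x y := fun x y => by
    simp only [hg]
    have := exp_add_exp_neg_sub_two_nonneg (φ x - φ y)
    rwa [neg_sub] at this
  have hgsymm : ∀ x y, g y x = g x y := fun x y => by simp only [hg]; ring
  have hnw0 : ∀ x, 0 ≤ nw x := fun x => by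
    simp only [hnw, dotProduct]; exact Finset.sum_nonneg fun i _ => mul_self_nonneg _
  -- the error as a bond sum
  have hsum : cerr (covLap c W) φ w = -∑ x, ∑ y, c x y * (g x y * (fld w x ⬝ᵥ (W x y *ᵥ fld w y))) := by
    rw [cerr_eq, covLap_biform, covLap_biform, ← Finset.sum_sub_distrib, ← Finset.sum_neg_distrib]
    refine Finset.sum_congr rfl fun x _ => ?_
    rw [← Finset.sum_sub_distrib, ← Finset.sum_neg_distrib]
    refine Finset.sum_congr rfl fun y _ => ?_
    rw [← mul_sub, bond_conj_identity (W x y) φ w x y, hg]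
    ring
  -- Cauchy–Schwarz per bond, orthogonality of the link variable
  have hpq : ∀ x y, fld w x ⬝ᵥ (W x y *ᵥ fld w y) ≤ (nw x + nw y) / 2 := by
    intro x y
    have h1 := two_mul_dotProduct_le (fld w x) (W x y *ᵥ fld w y)
    rw [orth_dotProduct_mulVec_self (hW x y)] at h1
    simp only [hnw]
    linarith
  have key : ∑ x, ∑ y, c x y * (g x y * (fld w x ⬝ᵥ (W x y *ᵥ fld w y))) ≤ Λ * (w ⬝ᵥ w) := by
    calc ∑ x, ∑ y, c x y * (g x y * (fld w x ⬝ᵥ (W x y *ᵥ fld w y)))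
        ≤ ∑ x, ∑ y, c x y * (g x y * ((nw x + nw y) / 2)) :=
          Finset.sum_le_sum fun x _ => Finset.sum_le_sum fun y _ =>
            mul_le_mul_of_nonneg_left (mul_le_mul_of_nonneg_left (hpq x y) (hg0 x y)) (hc x y)
      _ = ∑ x, ∑ y, (c x y * g x y * (nw x / 2) + c x y * g x y * (nw y / 2)) :=
          Finset.sum_congr rfl fun x _ => Finset.sum_congr rfl fun y _ => by ring
      _ = ∑ x, ∑ y, c x y * g x y * (nw x / 2) + ∑ x, ∑ y, c x y * g x y * (nw y / 2) := by
          simp only [Finset.sum_add_distrib]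
      _ = ∑ x, ∑ y, c x y * g x y * (nw x / 2) + ∑ y, ∑ x, c x y * g x y * (nw y / 2) := by
          congr 1
          exact Finset.sum_comm
      _ = ∑ x, ∑ y, (c x y + c y x) * g x y * (nw x / 2) := by
          rw [← Finset.sum_add_distrib]
          refine Finset.sum_congr rfl fun x _ => ?_
          rw [← Finset.sum_add_distrib]
          refine Finset.sum_congr rfl fun y _ => ?_
          rw [hgsymm x y]
          ring
      _ = (1 / 2) * ∑ x, nw x * ∑ y, (c x y + c y x) * g x y := by
          rw [Finset.mul_sum]
          refine Finset.sum_congr rfl fun x _ => ?_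
          rw [Finset.mul_sum, Finset.mul_sum]
          exact Finset.sum_congr rfl fun y _ => by ring
      _ ≤ (1 / 2) * ∑ x, nw x * (2 * Λ) := by
          refine mul_le_mul_of_nonneg_left (Finset.sum_le_sum fun x _ => ?_) (by norm_num)
          exact mul_le_mul_of_nonneg_left (hΛ x) (hnw0 x)
      _ = Λ * (w ⬝ᵥ w) := by
          rw [dotProduct_eq_sum_fld, ← Finset.sum_mul]
          simp only [hnw]
          ring
  rw [hsum]
  linarith

omit [Fintype X] in
/-- expanding the pairing of two weighted block sums. [folklore] -/
theorem sum_smul_dotProduct_sum_smul (s : Finset X) (α β : X → ℝ) (r : X → ι → ℝ) :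
    (∑ x ∈ s, α x • r x) ⬝ᵥ (∑ y ∈ s, β y • r y) = ∑ x ∈ s, ∑ y ∈ s, α x * β y * (r x ⬝ᵥ r y) := by
  rw [sum_dotProduct]
  refine Finset.sum_congr rfl fun x _ => ?_
  rw [dotProduct_sum]
  refine Finset.sum_congr rfl fun y _ => ?_
  rw [smul_dotProduct, dotProduct_smul, smul_eq_mul, smul_eq_mul]
  ring

/-- **CONJUGATION ERROR OF THE AVERAGING PART `P = Q^*Q` WITH ORTHOGONAL TRANSPORTERS**: if the weight oscillates
by at most `θ` on the support of each block row of `q` (`q(b,x) ≠ 0 ≠ q(b,y) ⇒ |φ(x) − φ(y)| ≤ θ`) and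
`Σ_b |q(b,x)| Σ_y |q(b,y)| ≤ M` for every `x`, then `−(e^θ − 1)M‖w‖² ≤ Σ_{j,k} (e^{φ_j−φ_k} − 1)P_{jk}w_jw_k` — the
transporters drop out because `|T(b,x)w(x)| = |w(x)|`. [cite: CombesThomas1973, §II] [folklore] -/
theorem cerr_projOp_ge [DecidableEq ι] (q : Y → X → ℝ) {T : Y → X → Matrix ι ι ℝ}
    (hT : ∀ b x, (T b x)ᵀ * T b x = 1) (φ : X → ℝ) {θ M : ℝ} (hθ : 0 ≤ θ)
    (hφ : ∀ b x y, q b x ≠ 0 → q b y ≠ 0 → |φ x - φ y| ≤ θ) (hM : ∀ x, ∑ b, |q b x| * ∑ y, |q b y| ≤ M)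
    (w : X × ι → ℝ) : -((Real.exp θ - 1) * M) * (w ⬝ᵥ w) ≤ cerr (projOp q T) φ w := by
  have hε : 0 ≤ Real.exp θ - 1 := by linarith [Real.add_one_le_exp θ]
  set nw : X → ℝ := fun x => fld w x ⬝ᵥ fld w x with hnw
  set r : Y → X → ι → ℝ := fun b x => T b x *ᵥ fld w x with hr
  have hnw0 : ∀ x, 0 ≤ nw x := fun x => by
    simp only [hnw, dotProduct]; exact Finset.sum_nonneg fun i _ => mul_self_nonneg _
  have hrr : ∀ b x, r b x ⬝ᵥ r b x = nw x := fun b x => orth_dotProduct_mulVec_self (hT b x) _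
  -- the error as a sum over blocks and pairs of sites
  have hQ : ∀ (ψ : X → ℝ) (b : Y), fld (avgOp q T *ᵥ wexp ψ w) b = ∑ x, (q b x * Real.exp (ψ x)) • r b x := by
    intro ψ b
    rw [fld_avgOp_mulVec]
    refine Finset.sum_congr rfl fun x _ => ?_
    rw [fld_wexp, Matrix.mulVec_smul, smul_smul]
  have hQw : ∀ b : Y, fld (avgOp q T *ᵥ w) b = ∑ x, (q b x * Real.exp ((fun _ : X => (0 : ℝ)) x)) • r b x := by
    intro b
    rw [fld_avgOp_mulVec]
    refine Finset.sum_congr rfl fun x _ => ?_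
    rw [Real.exp_zero, mul_one]
  have hsum : cerr (projOp q T) φ w
      = ∑ b, ∑ x, ∑ y, q b x * q b y * (Real.exp (φ x - φ y) - 1) * (r b x ⬝ᵥ r b y) := by
    rw [cerr_eq, projOp_biform, projOp_biform, dotProduct_eq_sum_fld, dotProduct_eq_sum_fld,
      ← Finset.sum_sub_distrib]
    refine Finset.sum_congr rfl fun b _ => ?_
    rw [hQ, hQ, hQw, sum_smul_dotProduct_sum_smul, sum_smul_dotProduct_sum_smul, ← Finset.sum_sub_distrib]
    refine Finset.sum_congr rfl fun x _ => ?_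
    rw [← Finset.sum_sub_distrib]
    refine Finset.sum_congr rfl fun y _ => ?_
    rw [Real.exp_sub, Real.exp_neg, Real.exp_zero, div_eq_mul_inv]
    ring
  -- per-term bound
  have hterm : ∀ b x y, -(|q b x| * |q b y| * (Real.exp θ - 1) * ((nw x + nw y) / 2))
      ≤ q b x * q b y * (Real.exp (φ x - φ y) - 1) * (r b x ⬝ᵥ r b y) := by
    intro b x y
    by_cases hx : q b x = 0
    · rw [hx]; simp
    by_cases hy : q b y = 0
    · rw [hy]; simp
    have h1 : |Real.exp (φ x - φ y) - 1| ≤ Real.exp θ - 1 := Beta.CombesThomasForm.abs_exp_sub_one_le (hφ b x y hx hy)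
    have h2 : |r b x ⬝ᵥ r b y| ≤ (nw x + nw y) / 2 := by
      have := two_mul_abs_dotProduct_le (r b x) (r b y)
      rw [hrr, hrr] at this
      linarith
    have h3 : |q b x * q b y * (Real.exp (φ x - φ y) - 1) * (r b x ⬝ᵥ r b y)|
        ≤ |q b x| * |q b y| * (Real.exp θ - 1) * ((nw x + nw y) / 2) := by
      rw [abs_mul, abs_mul, abs_mul]
      exact mul_le_mul (mul_le_mul_of_nonneg_left h1 (by positivity)) h2 (abs_nonneg _) (by
        have : 0 ≤ Real.exp θ - 1 := (abs_nonneg _).trans h1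
        positivity)
    linarith [neg_abs_le (q b x * q b y * (Real.exp (φ x - φ y) - 1) * (r b x ⬝ᵥ r b y))]
  -- summing the per-term bound
  have hpair : ∑ b, ∑ x, ∑ y, |q b x| * |q b y| * ((nw x + nw y) / 2) = ∑ x, nw x * ∑ b, |q b x| * ∑ y, |q b y| := by
    have h1 : ∀ b : Y, ∑ x, ∑ y, |q b x| * |q b y| * ((nw x + nw y) / 2)
        = ∑ x, nw x * (|q b x| * ∑ y, |q b y|) := by
      intro b
      calc ∑ x, ∑ y, |q b x| * |q b y| * ((nw x + nw y) / 2)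
          = ∑ x, ∑ y, |q b x| * |q b y| * (nw x / 2) + ∑ x, ∑ y, |q b x| * |q b y| * (nw y / 2) := by
            rw [← Finset.sum_add_distrib]
            refine Finset.sum_congr rfl fun x _ => ?_
            rw [← Finset.sum_add_distrib]
            exact Finset.sum_congr rfl fun y _ => by ring
        _ = ∑ x, ∑ y, |q b x| * |q b y| * (nw x / 2) + ∑ y, ∑ x, |q b x| * |q b y| * (nw y / 2) := by
            congr 1; exact Finset.sum_comm
        _ = ∑ x, nw x * (|q b x| * ∑ y, |q b y|) := by
            rw [← Finset.sum_add_distrib]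
            refine Finset.sum_congr rfl fun x _ => ?_
            rw [← Finset.sum_add_distrib, Finset.mul_sum, Finset.mul_sum]
            exact Finset.sum_congr rfl fun y _ => by ring
    simp_rw [h1]
    rw [Finset.sum_comm]
    refine Finset.sum_congr rfl fun x _ => ?_
    rw [Finset.mul_sum]
  have hww : w ⬝ᵥ w = ∑ x, nw x := dotProduct_eq_sum_fld w w
  rw [hsum]
  calc -((Real.exp θ - 1) * M) * (w ⬝ᵥ w)
      ≤ -((Real.exp θ - 1) * ∑ x, nw x * ∑ b, |q b x| * ∑ y, |q b y|) := by
        rw [hww, neg_mul]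
        apply neg_le_neg
        rw [Finset.mul_sum, Finset.mul_sum]
        refine Finset.sum_le_sum fun x _ => ?_
        calc (Real.exp θ - 1) * (nw x * ∑ b, |q b x| * ∑ y, |q b y|)
            = (Real.exp θ - 1) * nw x * (∑ b, |q b x| * ∑ y, |q b y|) := by ring
          _ ≤ (Real.exp θ - 1) * nw x * M := mul_le_mul_of_nonneg_left (hM x) (mul_nonneg hε (hnw0 x))
          _ = (Real.exp θ - 1) * M * nw x := by ring
    _ = -∑ b, ∑ x, ∑ y, |q b x| * |q b y| * (Real.exp θ - 1) * ((nw x + nw y) / 2) := by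
        rw [← hpair, Finset.mul_sum]
        congr 1
        refine Finset.sum_congr rfl fun b _ => ?_
        rw [Finset.mul_sum]
        refine Finset.sum_congr rfl fun x _ => ?_
        rw [Finset.mul_sum]
        exact Finset.sum_congr rfl fun y _ => by ring
    _ ≤ ∑ b, ∑ x, ∑ y, q b x * q b y * (Real.exp (φ x - φ y) - 1) * (r b x ⬝ᵥ r b y) := by
        rw [← Finset.sum_neg_distrib]
        refine Finset.sum_le_sum fun b _ => ?_
        rw [← Finset.sum_neg_distrib]
        refine Finset.sum_le_sum fun x _ => ?_
        rw [← Finset.sum_neg_distrib]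
        exact Finset.sum_le_sum fun y _ => hterm b x y

/-- `e^{t} + e^{−t} − 2 ≤ 2t²` for `|t| ≤ 1`. [folklore] -/
theorem exp_add_exp_neg_sub_two_le {t : ℝ} (ht : |t| ≤ 1) : Real.exp t + Real.exp (-t) - 2 ≤ 2 * t ^ 2 := by
  have h1 := (abs_le.1 (Real.abs_exp_sub_one_sub_id_le ht)).2
  have h2 := (abs_le.1 (Real.abs_exp_sub_one_sub_id_le (x := -t) (by rwa [abs_neg]))).2
  nlinarith

/-- **CONJUGATION ERROR OF `−Δ_W + m² + aQ^*Q`** (sum of the two bounds; the mass is diagonal and contributes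
nothing). [cite: CombesThomas1973, §II] [folklore] -/
theorem cerr_covOp_ge [DecidableEq X] [DecidableEq ι] {c : X → X → ℝ} (hc : ∀ x y, 0 ≤ c x y)
    {W : X → X → Matrix ι ι ℝ} (hW : ∀ x y, (W x y)ᵀ * W x y = 1) (q : Y → X → ℝ)
    {T : Y → X → Matrix ι ι ℝ} (hT : ∀ b x, (T b x)ᵀ * T b x = 1) (φ : X → ℝ) {Λ θ M : ℝ} (hθ : 0 ≤ θ)
    (hΛ : ∀ x, ∑ y, (c x y + c y x) * (Real.exp (φ x - φ y) + Real.exp (φ y - φ x) - 2) ≤ 2 * Λ)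
    (hφ : ∀ b x y, q b x ≠ 0 → q b y ≠ 0 → |φ x - φ y| ≤ θ) (hM : ∀ x, ∑ b, |q b x| * ∑ y, |q b y| ≤ M)
    (m2 : ℝ) {a : ℝ} (ha : 0 ≤ a) (w : X × ι → ℝ) :
    -(Λ + a * ((Real.exp θ - 1) * M)) * (w ⬝ᵥ w) ≤ cerr (covOp c m2 a q W T) φ w := by
  rw [covOp, cerr_add, cerr_add, cerr_smul, cerr_smul, cerr_one, mul_zero, add_zero]
  have h1 := cerr_covLap_ge hc hW φ hΛ w
  have h2 := cerr_projOp_ge q hT φ hθ hφ hM w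
  have h3 : a * (-((Real.exp θ - 1) * M) * (w ⬝ᵥ w)) ≤ a * cerr (projOp q T) φ w :=
    mul_le_mul_of_nonneg_left h2 ha
  nlinarith

end ConjError

/-! ## §B  The conjugation error of [B4]'s region operator `−Δ^{η,N}_{A,Ω} + m² + a_kP_k(A)` -/

section Region

open Literature.MathematicalPhysics.QuantumFieldTheory.Balaban1983to89.B4ContourShift (supNorm supNorm_nonneg)
open Literature.MathematicalPhysics.QuantumFieldTheory.Balaban1983to89.B4Reflection242 (nbrs nbrs_comm blk)
open Literature.MathematicalPhysics.QuantumFieldTheory.Balaban1983to89.B4BoxCov237 (supNorm_sub_le_of_blk_eq)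
open Literature.MathematicalPhysics.QuantumFieldTheory.Balaban1983to89.B4Lower18
  (fineDom mem_fineDom edistR supNorm_sub_le_one_of_mem_nbrs)
open Literature.MathematicalPhysics.QuantumFieldTheory.Balaban1983to89.B4Lower18RegularRegion
  (regWt rBlkWt rbaseEmb rstairContour compField regWt_nonneg rBlkWt_nonneg rBlkWt_ne_zero card_filter_nbrs_le
    sum_rBlkWt_row sum_rBlkWt_col)
open Literature.MathematicalPhysics.QuantumFieldTheory.Balaban1983to89.B4Lemma21Region (regionOp regionDeriv)

variable {d : ℕ} {ι : Type*} [Fintype ι] [DecidableEq ι]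

/-- **THE `η`-UNIFORM CONJUGATION-ERROR BOUND FOR [B4]'s REGION OPERATOR AT `A ≠ 0`**: for a site weight `φ` that
is `δ`-Lipschitz for the `η`-scaled sup-distance (`0 ≤ δ ≤ 1`) and EVERY vector field `A`, flow `U`, charge `e`,
mass `m²`:  `−(2(d+1)δ² + a(e^δ − 1))‖w‖² ≤ Σ_{j,k} (e^{φ_j − φ_k} − 1) H_{jk} w_j w_k`,
`H = −Δ^{η,N}_{A,Ω} + m² + a P_k(A)` — the SAME constant as at `A = 0` (`B4Cor23Zero.herr_region`): the orthogonal
link variables and parallel transporters are invisible to the Combes–Thomas conjugation.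
[cite: CombesThomas1973, §II] [cite: Balaban1983RegularityDecay, p. 572 (1.6) (the operator
`−Δ^{η,N}_{A,Ω} + m² + a_kP_k(A)` whose inverse is `G_k(Ω,A)`)] [folklore] -/
theorem cerr_regionOp_ge (F : OrthFlow ι) (e : ℝ) {n : ℕ} (hn : 1 ≤ n) {a : ℝ} (ha : 0 ≤ a) (m2 : ℝ)
    (Ωc : Finset (Fin (d + 1) → ℤ)) (Ac : (Fin (d + 1) → ℤ) → Fin (d + 1) → ℝ) {δ : ℝ} (hδ0 : 0 ≤ δ)
    (hδ1 : δ ≤ 1) (φ : ↥(fineDom n Ωc) → ℝ) (hφ : ∀ x y, |φ x - φ y| ≤ δ * edistR n (fineDom n Ωc) x y)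
    (w : ↥(fineDom n Ωc) × ι → ℝ) :
    -(2 * ((d : ℝ) + 1) * δ ^ 2 + a * (Real.exp δ - 1)) * (w ⬝ᵥ w) ≤ cerr (regionOp F e hn a m2 Ωc Ac) φ w := by
  have hn0 : (0 : ℝ) < n := by exact_mod_cast hn
  have hn1 : (1 : ℝ) ≤ n := by exact_mod_cast hn
  have hN : (0 : ℝ) < (n : ℝ) ^ (d + 1) := by positivity
  -- the Laplacian part: `Λ = 2(d+1)δ²`
  have hΛ : ∀ x : ↥(fineDom n Ωc), ∑ y, (regWt n (fineDom n Ωc) x y + regWt n (fineDom n Ωc) y x)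
      * (Real.exp (φ x - φ y) + Real.exp (φ y - φ x) - 2) ≤ 2 * (2 * ((d : ℝ) + 1) * δ ^ 2) := by
    intro x
    have hterm : ∀ y : ↥(fineDom n Ωc), (regWt n (fineDom n Ωc) x y + regWt n (fineDom n Ωc) y x) * (Real.exp (φ x - φ y) + Real.exp (φ y - φ x) - 2)
        ≤ (if y.1 ∈ nbrs x.1 then 2 * δ ^ 2 else 0) := by
      intro y
      unfold regWt
      by_cases hy : y.1 ∈ nbrs x.1
      · have hx : x.1 ∈ nbrs y.1 := nbrs_comm.1 hy
        rw [if_pos hy, if_pos hx, if_pos hy]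
        have hd : edistR n (fineDom n Ωc) x y ≤ 1 / (n : ℝ) := by
          unfold edistR
          exact mul_le_of_le_one_right (by positivity) (supNorm_sub_le_one_of_mem_nbrs hy)
        have ht : |φ x - φ y| ≤ δ / (n : ℝ) := (hφ x y).trans (by
          calc δ * edistR n (fineDom n Ωc) x y ≤ δ * (1 / (n : ℝ)) := mul_le_mul_of_nonneg_left hd hδ0
            _ = δ / (n : ℝ) := by ring)
        have ht1 : |φ x - φ y| ≤ 1 := ht.trans (by rw [div_le_one hn0]; exact hδ1.trans hn1)
        have hg := exp_add_exp_neg_sub_two_le ht1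
        rw [neg_sub] at hg
        have hsq : (φ x - φ y) ^ 2 ≤ (δ / (n : ℝ)) ^ 2 := by
          rw [← sq_abs]; exact pow_le_pow_left₀ (abs_nonneg _) ht 2
        calc ((n : ℝ) ^ 2 / 2 * 1 + (n : ℝ) ^ 2 / 2 * 1) * (Real.exp (φ x - φ y) + Real.exp (φ y - φ x) - 2)
            ≤ ((n : ℝ) ^ 2 / 2 * 1 + (n : ℝ) ^ 2 / 2 * 1) * (2 * (δ / (n : ℝ)) ^ 2) :=
              mul_le_mul_of_nonneg_left (hg.trans (by linarith)) (by positivity)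
          _ = 2 * δ ^ 2 := by field_simp; ring
      · have hx : x.1 ∉ nbrs y.1 := fun h => hy (nbrs_comm.1 h)
        rw [if_neg hy, if_neg hx, if_neg hy]
        simp
    calc ∑ y, (regWt n (fineDom n Ωc) x y + regWt n (fineDom n Ωc) y x) * (Real.exp (φ x - φ y) + Real.exp (φ y - φ x) - 2)
        ≤ ∑ y : ↥(fineDom n Ωc), (if y.1 ∈ nbrs x.1 then 2 * δ ^ 2 else 0) := Finset.sum_le_sum fun y _ => hterm y
      _ = 2 * δ ^ 2 * ((Finset.univ.filter fun y : ↥(fineDom n Ωc) => y.1 ∈ nbrs x.1).card : ℝ) := by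
          rw [← Finset.sum_filter, Finset.sum_const, nsmul_eq_mul, mul_comm]
      _ ≤ 2 * δ ^ 2 * (2 * ((d : ℝ) + 1)) := mul_le_mul_of_nonneg_left (card_filter_nbrs_le (fineDom n Ωc) x) (by positivity)
      _ = 2 * (2 * ((d : ℝ) + 1) * δ ^ 2) := by ring
  -- the averaging part: `θ = δ`, `M = n^{d+1}`
  have hθ : ∀ (b : ↥Ωc) (x y : ↥(fineDom n Ωc)), rBlkWt n Ωc (fineDom n Ωc) b x ≠ 0 → rBlkWt n Ωc (fineDom n Ωc) b y ≠ 0 → |φ x - φ y| ≤ δ := by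
    intro b x y hx hy
    have hb : blk n x.1 = blk n y.1 := (rBlkWt_ne_zero hx).trans (rBlkWt_ne_zero hy).symm
    have hd : edistR n (fineDom n Ωc) x y ≤ 1 := by
      unfold edistR
      calc 1 / (n : ℝ) * supNorm (x.1 - y.1) ≤ 1 / (n : ℝ) * ((n : ℝ) - 1) :=
            mul_le_mul_of_nonneg_left (supNorm_sub_le_of_blk_eq hn hb) (by positivity)
        _ ≤ 1 := by rw [div_mul_eq_mul_div, one_mul, div_le_one hn0]; linarith
    calc |φ x - φ y| ≤ δ * edistR n (fineDom n Ωc) x y := hφ x y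
      _ ≤ δ * 1 := mul_le_mul_of_nonneg_left hd hδ0
      _ = δ := mul_one δ
  have hM : ∀ x : ↥(fineDom n Ωc), ∑ b, |rBlkWt n Ωc (fineDom n Ωc) b x| * ∑ y, |rBlkWt n Ωc (fineDom n Ωc) b y| ≤ (n : ℝ) ^ (d + 1) := by
    intro x
    have habs : ∀ (b : ↥Ωc) (y : ↥(fineDom n Ωc)), |rBlkWt n Ωc (fineDom n Ωc) b y| = rBlkWt n Ωc (fineDom n Ωc) b y :=
      fun b y => abs_of_nonneg (rBlkWt_nonneg n Ωc (fineDom n Ωc) b y)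
    simp only [habs]
    calc ∑ b, rBlkWt n Ωc (fineDom n Ωc) b x * ∑ y, rBlkWt n Ωc (fineDom n Ωc) b y
        ≤ ∑ b, rBlkWt n Ωc (fineDom n Ωc) b x * (n : ℝ) ^ (d + 1) :=
          Finset.sum_le_sum fun b _ => mul_le_mul_of_nonneg_left (sum_rBlkWt_row hn Ωc b) (rBlkWt_nonneg n Ωc (fineDom n Ωc) b x)
      _ = (∑ b, rBlkWt n Ωc (fineDom n Ωc) b x) * (n : ℝ) ^ (d + 1) := (Finset.sum_mul _ _ _).symm
      _ ≤ 1 * (n : ℝ) ^ (d + 1) := mul_le_mul_of_nonneg_right (sum_rBlkWt_col n Ωc (fineDom n Ωc) x) hN.le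
      _ = (n : ℝ) ^ (d + 1) := one_mul _
  -- orthogonality of the link variables and of the transporters
  have hW : ∀ x y : ↥(fineDom n Ωc), (fieldLink F (e / n) (fun u v : ↥(fineDom n Ωc) => compField Ac u.1 v.1) x y)ᵀ
      * fieldLink F (e / n) (fun u v : ↥(fineDom n Ωc) => compField Ac u.1 v.1) x y = 1 := fun x y => F.orth _
  have hT : ∀ (b : ↥Ωc) (x : ↥(fineDom n Ωc)),
      (contourTrans (fieldLink F (e / n) (fun u v : ↥(fineDom n Ωc) => compField Ac u.1 v.1)) (rbaseEmb hn Ωc)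
          (rstairContour hn Ωc) b x)ᵀ
        * contourTrans (fieldLink F (e / n) (fun u v : ↥(fineDom n Ωc) => compField Ac u.1 v.1)) (rbaseEmb hn Ωc)
          (rstairContour hn Ωc) b x = 1 := by
    intro b x
    simp only [contourTrans, transport_fieldLink]
    exact F.orth _
  have h := cerr_covOp_ge (regWt_nonneg n (fineDom n Ωc)) hW (rBlkWt n Ωc (fineDom n Ωc)) hT φ hδ0 hΛ hθ hM m2
    (a := a * ((n : ℝ) ^ (d + 1))⁻¹) (by positivity) w
  have hconst : 2 * ((d : ℝ) + 1) * δ ^ 2 + a * ((n : ℝ) ^ (d + 1))⁻¹ * ((Real.exp δ - 1) * (n : ℝ) ^ (d + 1))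
      = 2 * ((d : ℝ) + 1) * δ ^ 2 + a * (Real.exp δ - 1) := by
    field_simp
  rw [hconst] at h
  exact h

end Region

/-! ## §C  The weighted covariant Leibniz rule (squared, sitewise) and the shifted field -/

section Leibniz

open Literature.MathematicalPhysics.QuantumFieldTheory.Balaban1983to89.B4Lemma21Region
  (covDeriv fld_covDeriv_mulVec_of_mem fld_covDeriv_mulVec_of_not_mem)
open Literature.MathematicalPhysics.QuantumFieldTheory.Balaban1983to89.B4Cor23Zero (nat_mul_abs_exp_sub_one_le)

variable {d : ℕ} {ι : Type*} [Fintype ι] [DecidableEq ι] {n : ℕ} {R : Finset (Fin (d + 1) → ℤ)}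

omit [Fintype ι] [DecidableEq ι] in
/-- undoing a site weight: `e^{−ψ}(e^{ψ}v) = v`. [folklore] -/
theorem wexp_neg_wexp (ψ : ↥R → ℝ) (v : ↥R × ι → ℝ) : wexp (fun x => -ψ x) (wexp ψ v) = v := by
  funext j
  simp only [wexp_apply, Real.exp_neg]
  rw [← mul_assoc, inv_mul_cancel₀ (Real.exp_pos _).ne', one_mul]

omit [DecidableEq ι] in
/-- `|e^{ψ}w|² = Σ_j (e^{ψ_j} w_j)²`-type identity: `⟨u,u⟩ = Σ_j (e^{ψ(j₁)} w_j)²` for `u = e^{ψ}w`. [folklore] -/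
theorem wexp_dot_self (ψ : ↥R → ℝ) (w : ↥R × ι → ℝ) :
    wexp ψ w ⬝ᵥ wexp ψ w = ∑ j, (Real.exp (ψ j.1) * w j) ^ 2 := by
  simp only [dotProduct, wexp_apply, sq]

/-- the value of a field at the forward `μ`-neighbour of a site (`0` if that neighbour is outside the region).
[folklore] -/
def shft (w : ↥R × ι → ℝ) (μ : Fin (d + 1)) (x : ↥R) : ι → ℝ :=
  if h : x.1 + e1 μ ∈ R then fld w ⟨x.1 + e1 μ, h⟩ else 0

omit [DecidableEq ι] in
/-- shifted squares are dominated by all squares: `Σ_{x∈S} |w(x + ηe_μ)|² ≤ ‖w‖²` (the shift is injective).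
[folklore] -/
theorem sum_shft_sq_le (w : ↥R × ι → ℝ) (μ : Fin (d + 1)) (S : Finset ↥R) :
    ∑ x ∈ S, shft w μ x ⬝ᵥ shft w μ x ≤ w ⬝ᵥ w := by
  classical
  set S' := S.filter (fun x : ↥R => x.1 + e1 μ ∈ R) with hS'
  set τ : ↥R → ↥R := fun x => if h : x.1 + e1 μ ∈ R then ⟨x.1 + e1 μ, h⟩ else x with hτ
  have h0 : ∀ y : ↥R, 0 ≤ fld w y ⬝ᵥ fld w y := fun y => by
    simp only [dotProduct]; exact Finset.sum_nonneg fun i _ => mul_self_nonneg _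
  have h1 : ∑ x ∈ S, shft w μ x ⬝ᵥ shft w μ x = ∑ x ∈ S', fld w (τ x) ⬝ᵥ fld w (τ x) := by
    rw [hS', Finset.sum_filter]
    refine Finset.sum_congr rfl fun x _ => ?_
    by_cases h : x.1 + e1 μ ∈ R
    · rw [if_pos h, shft, dif_pos h, hτ]
      simp only [h, dif_pos]
    · rw [if_neg h, shft, dif_neg h]; simp
  have hinj : ∀ x ∈ S', ∀ y ∈ S', τ x = τ y → x = y := by
    intro x hx y hy hxy
    rw [hS', Finset.mem_filter] at hx hy
    simp only [hτ, hx.2, hy.2] at hxy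
    exact Subtype.ext (add_right_cancel (Subtype.ext_iff.1 hxy))
  have h2 : ∑ x ∈ S', fld w (τ x) ⬝ᵥ fld w (τ x) = ∑ y ∈ S'.image τ, fld w y ⬝ᵥ fld w y :=
    (Finset.sum_image (f := fun y => fld w y ⬝ᵥ fld w y) hinj).symm
  rw [h1, h2, dotProduct_eq_sum_fld]
  exact Finset.sum_le_sum_of_subset_of_nonneg (Finset.subset_univ _) fun y _ _ => h0 y

omit [DecidableEq ι] in
/-- `|p + q|² ≤ 2(|p|² + |q|²)`. [folklore] -/
theorem add_dot_add_le (p q : ι → ℝ) : (p + q) ⬝ᵥ (p + q) ≤ 2 * (p ⬝ᵥ p + q ⬝ᵥ q) := by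
  have h := two_mul_dotProduct_le p q
  simp only [add_dotProduct, dotProduct_add, dotProduct_comm q p]
  linarith

/-- **THE WEIGHTED COVARIANT LEIBNIZ RULE, SQUARED**: for `u = e^{ψ}w` with `|ψ(x + ηe_μ) − ψ(x)| ≤ δη`, `δ ≤ 1`,
and ORTHOGONAL link variables: `|(D^η_{W,μ}u)(x)|² ≤ 2e^{2ψ(x)}(|(D^η_{W,μ}w)(x)|² + 4δ²|w(x + ηe_μ)|²)` — from
`(D_W u)(x) = e^{ψ(x)}[(D_W w)(x) + η^{-1}(e^{ψ(x+ηe_μ)−ψ(x)} − 1)·W w(x+ηe_μ)]`, `η^{-1}|e^{t} − 1| ≤ 2δ`,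
`|Wv| = |v|`. [cite: CombesThomas1973, §II] [folklore] -/
theorem covLeibniz_sq_le (hn : 1 ≤ n) {W : ↥R → ↥R → Matrix ι ι ℝ} (hW : ∀ x y, (W x y)ᵀ * W x y = 1)
    (μ : Fin (d + 1)) {δ : ℝ} (hδ1 : δ ≤ 1) (ψ : ↥R → ℝ)
    (hψ : ∀ (x : ↥R) (h : x.1 + e1 μ ∈ R), |ψ ⟨x.1 + e1 μ, h⟩ - ψ x| ≤ δ / (n : ℝ)) (w : ↥R × ι → ℝ) (x : ↥R) :
    fld (covDeriv n R W μ *ᵥ wexp ψ w) x ⬝ᵥ fld (covDeriv n R W μ *ᵥ wexp ψ w) x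
      ≤ 2 * Real.exp (ψ x) ^ 2
        * (fld (covDeriv n R W μ *ᵥ w) x ⬝ᵥ fld (covDeriv n R W μ *ᵥ w) x + 4 * δ ^ 2 * (shft w μ x ⬝ᵥ shft w μ x)) := by
  by_cases h : x.1 + e1 μ ∈ R
  · set xp : ↥R := ⟨x.1 + e1 μ, h⟩ with hxp
    set t : ℝ := ψ xp - ψ x with ht
    set A : ι → ℝ := fld (covDeriv n R W μ *ᵥ w) x with hA
    set B : ι → ℝ := ((n : ℝ) * (Real.exp t - 1)) • (W x xp *ᵥ fld w xp) with hB
    have hAeq : A = (n : ℝ) • (W x xp *ᵥ fld w xp - fld w x) := fld_covDeriv_mulVec_of_mem n W w h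
    have hU : fld (covDeriv n R W μ *ᵥ wexp ψ w) x = Real.exp (ψ x) • (A + B) := by
      rw [fld_covDeriv_mulVec_of_mem n W _ h, fld_wexp, fld_wexp, Matrix.mulVec_smul, hAeq, hB, ht]
      rw [Real.exp_sub]
      have hx0 : Real.exp (ψ x) ≠ 0 := (Real.exp_pos _).ne'
      funext i
      simp only [Pi.smul_apply, Pi.sub_apply, Pi.add_apply, smul_eq_mul]
      field_simp
      ring
    have hshft : shft w μ x = fld w xp := by rw [shft, dif_pos h]
    have hBB : B ⬝ᵥ B ≤ 4 * δ ^ 2 * (shft w μ x ⬝ᵥ shft w μ x) := by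
      rw [hshft, hB, smul_dotProduct, dotProduct_smul, smul_eq_mul, smul_eq_mul,
        orth_dotProduct_mulVec_self (hW x xp), ← mul_assoc]
      refine mul_le_mul_of_nonneg_right ?_ (by
        simp only [dotProduct]; exact Finset.sum_nonneg fun i _ => mul_self_nonneg _)
      have h1 : (n : ℝ) * |Real.exp t - 1| ≤ 2 * δ := nat_mul_abs_exp_sub_one_le hn hδ1 (hψ x h)
      have h2 : |(n : ℝ) * (Real.exp t - 1)| ≤ 2 * δ := by
        rw [abs_mul, abs_of_nonneg (by positivity : (0 : ℝ) ≤ n)]; exact h1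
      have h3 := sq_le_sq' (by linarith [neg_abs_le ((n : ℝ) * (Real.exp t - 1)), abs_nonneg ((n : ℝ) * (Real.exp t - 1))])
        ((le_abs_self _).trans h2)
      nlinarith
    rw [hU, smul_dotProduct, dotProduct_smul, smul_eq_mul, smul_eq_mul, ← mul_assoc, ← sq]
    have hE : 0 ≤ Real.exp (ψ x) ^ 2 := sq_nonneg _
    calc Real.exp (ψ x) ^ 2 * ((A + B) ⬝ᵥ (A + B)) ≤ Real.exp (ψ x) ^ 2 * (2 * (A ⬝ᵥ A + B ⬝ᵥ B)) :=
          mul_le_mul_of_nonneg_left (add_dot_add_le A B) hE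
      _ ≤ Real.exp (ψ x) ^ 2 * (2 * (A ⬝ᵥ A + 4 * δ ^ 2 * (shft w μ x ⬝ᵥ shft w μ x))) :=
          mul_le_mul_of_nonneg_left (by linarith) hE
      _ = _ := by ring
  · rw [fld_covDeriv_mulVec_of_not_mem n W _ h]
    simp only [zero_dotProduct]
    have h1 : 0 ≤ fld (covDeriv n R W μ *ᵥ w) x ⬝ᵥ fld (covDeriv n R W μ *ᵥ w) x := by
      simp only [dotProduct]; exact Finset.sum_nonneg fun i _ => mul_self_nonneg _
    have h2 : 0 ≤ shft w μ x ⬝ᵥ shft w μ x := by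
      simp only [dotProduct]; exact Finset.sum_nonneg fun i _ => mul_self_nonneg _
    positivity

/-- moving the adjoint derivative across the pairing: `⟨u, D^{η*}f'⟩ = ⟨D^η u, f'⟩`. [folklore] -/
theorem dot_transpose_mulVec {J : Type*} [Fintype J] (M : Matrix J J ℝ) (u f' : J → ℝ) :
    u ⬝ᵥ (Mᵀ *ᵥ f') = (M *ᵥ u) ⬝ᵥ f' := by
  rw [Matrix.dotProduct_mulVec, Matrix.vecMul_transpose]

end Leibniz

/-! ## §D  The abstract one-step Combes–Thomas estimate for a block operator on a region: energies and set-to-set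
decay of `G`, `D_μG`, `GD_ν^*`, `D_μGD_ν^*` -/

section Decay

open Literature.MathematicalPhysics.QuantumFieldTheory.Balaban1983to89.B4Lower18 (edistR)
open Literature.MathematicalPhysics.QuantumFieldTheory.Balaban1983to89.B4Lemma21Region (covDeriv mulVec_inv_mulVec)
open Literature.MathematicalPhysics.QuantumFieldTheory.Balaban1983to89.B4Cor23Zero
  (ctw ctw_le_zero_of_mem le_ctw abs_ctw_sub_le edistR_step_le energy_le_two_conjPairing le_four_mul_of_sq_le)
open Beta.CombesThomasFormOp (weightedSq_le_of_support setSq_le_of_weightedSq)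

variable {d : ℕ} {ι : Type*} [Fintype ι] [DecidableEq ι] {n : ℕ} {R : Finset (Fin (d + 1) → ℤ)}

/-- **THE HYPOTHESES OF THE ABSTRACT STEP** for a block operator `H` on `R × ι` with link variables `W`, coercivity
constant `σ` and rate `δ`: mesh `η = 1/n ≤ 1`; `σ‖Φ‖² ≤ ⟨Φ, HΦ⟩`; `‖D^η_{W,μ}Φ‖² ≤ ⟨Φ, HΦ⟩` for every direction;
`W` orthogonal; `0 ≤ δ ≤ 1`; and the conjugation-error bound `−(σ/2)‖w‖² ≤ Σ (e^{φ_j−φ_k} − 1)H_{jk}w_jw_k` for every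
Combes–Thomas weight `φ = δ·dist_η(·,T)`.  (A bundle of hypotheses, each DISCHARGED for [B4]'s region operator in
§F below; nothing is assumed about [B4].) [folklore] -/
structure CTHyp (n : ℕ) (R : Finset (Fin (d + 1) → ℤ)) (H : Matrix (↥R × ι) (↥R × ι) ℝ)
    (W : ↥R → ↥R → Matrix ι ι ℝ) (σ δ : ℝ) : Prop where
  one_le : 1 ≤ n
  pos : 0 < σ
  coercive : ∀ Φ : ↥R × ι → ℝ, σ * (Φ ⬝ᵥ Φ) ≤ Φ ⬝ᵥ (H *ᵥ Φ)
  deriv : ∀ (μ : Fin (d + 1)) (Φ : ↥R × ι → ℝ),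
    (covDeriv n R W μ *ᵥ Φ) ⬝ᵥ (covDeriv n R W μ *ᵥ Φ) ≤ Φ ⬝ᵥ (H *ᵥ Φ)
  orth : ∀ x y, (W x y)ᵀ * W x y = 1
  nonneg : 0 ≤ δ
  le_one : δ ≤ 1
  err : ∀ (T : Finset ↥R) (hT : T.Nonempty) (w : ↥R × ι → ℝ), -(σ / 2) * (w ⬝ᵥ w) ≤ cerr H (ctw n R δ T hT) w

variable {H : Matrix (↥R × ι) (↥R × ι) ℝ} {W : ↥R → ↥R → Matrix ι ι ℝ} {σ δ : ℝ}

omit [DecidableEq ι] in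
/-- `⟨v,v⟩ = Σ_j v_j²`. [folklore] -/
theorem dot_self_eq_sum_sq (v : ↥R × ι → ℝ) : v ⬝ᵥ v = ∑ j, v j ^ 2 := by
  simp only [dotProduct, sq]

omit [DecidableEq ι] in
/-- `0 ≤ ⟨v,v⟩`. [folklore] -/
theorem dot_self_nonneg (v : ↥R × ι → ℝ) : 0 ≤ v ⬝ᵥ v := by
  rw [dot_self_eq_sum_sq]; exact Finset.sum_nonneg fun j _ => sq_nonneg _

omit [DecidableEq ι] in
/-- a site sum of pairings is a sum over the cylinder `S × ι`. [folklore] -/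
theorem sum_fld_dot_eq (S : Finset ↥R) (Φ Ψ : ↥R × ι → ℝ) :
    ∑ x ∈ S, fld Φ x ⬝ᵥ fld Ψ x = ∑ j ∈ S ×ˢ (Finset.univ : Finset ι), Φ j * Ψ j := by
  rw [Finset.sum_product]
  rfl

omit [DecidableEq ι] in
/-- Cauchy–Schwarz for site sums of pairings: `(Σ_{x∈S} ⟨p(x),q(x)⟩)² ≤ (Σ_{x∈S}|p(x)|²)(Σ_{x∈S}|q(x)|²)`.
[folklore] -/
theorem sq_sum_fld_dot_le (S : Finset ↥R) (Φ Ψ : ↥R × ι → ℝ) :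
    (∑ x ∈ S, fld Φ x ⬝ᵥ fld Ψ x) ^ 2 ≤ (∑ x ∈ S, fld Φ x ⬝ᵥ fld Φ x) * ∑ x ∈ S, fld Ψ x ⬝ᵥ fld Ψ x := by
  rw [sum_fld_dot_eq, sum_fld_dot_eq, sum_fld_dot_eq]
  have := Finset.sum_mul_sq_le_sq_mul_sq (S ×ˢ (Finset.univ : Finset ι)) Φ Ψ
  simpa only [sq] using this

omit [Fintype ι] [DecidableEq ι] in
/-- a field supported over `T` vanishes sitewise off `T`. [folklore] -/
theorem fld_eq_zero_of_not_mem {T : Finset ↥R} (g : ↥R × ι → ℝ) (hg : ∀ j, j.1 ∉ T → g j = 0) {x : ↥R}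
    (hx : x ∉ T) : fld g x = 0 := by
  funext i; exact hg (x, i) hx

omit [Fintype ι] [DecidableEq ι] in
/-- the zero field sitewise. [folklore] -/
theorem fld_zero (x : ↥R) : fld (0 : ↥R × ι → ℝ) x = 0 := by
  funext i; rfl

omit [Fintype ι] [DecidableEq ι] in
/-- a field supported over the empty set vanishes. [folklore] -/
theorem eq_zero_of_supp_empty {T : Finset ↥R} (hT : ¬T.Nonempty) (g : ↥R × ι → ℝ)
    (hg : ∀ j, j.1 ∉ T → g j = 0) : g = 0 := by
  funext j; exact hg j (fun hj => hT ⟨j.1, hj⟩)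

omit [DecidableEq ι] in
/-- off `T` means off the cylinder `T × ι`. [folklore] -/
theorem supp_cyl {T : Finset ↥R} (g : ↥R × ι → ℝ) (hg : ∀ j, j.1 ∉ T → g j = 0) :
    ∀ j, j ∉ T ×ˢ (Finset.univ : Finset ι) → g j = 0 :=
  fun j hj => hg j (fun h1 => hj (Finset.mk_mem_product h1 (Finset.mem_univ _)))

/-- across a bond the Combes–Thomas weight oscillates by at most `δη`. [folklore] -/
theorem ctw_bond_le (hδ0 : 0 ≤ δ) (T : Finset ↥R) (hT : T.Nonempty) (μ : Fin (d + 1)) (x : ↥R)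
    (h : x.1 + e1 μ ∈ R) : |ctw n R δ T hT ⟨x.1 + e1 μ, h⟩ - ctw n R δ T hT x| ≤ δ / (n : ℝ) := by
  rw [abs_sub_comm]
  calc |ctw n R δ T hT x - ctw n R δ T hT ⟨x.1 + e1 μ, h⟩| ≤ δ * edistR n R x ⟨x.1 + e1 μ, h⟩ :=
        abs_ctw_sub_le hδ0 T hT _ _
    _ ≤ δ * (1 / (n : ℝ)) := mul_le_mul_of_nonneg_left (edistR_step_le x μ h) hδ0
    _ = δ / (n : ℝ) := by ring

/-- **ENERGY BOUND, CASE A (source supported over `T`)**: `v = Gg`, `w = e^{φ}v`, `φ = δ·dist_η(·,T)`: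
`⟨w, Hw⟩ ≤ (4/σ)‖g‖²`. [cite: CombesThomas1973, §II] [folklore] -/
theorem energyA (h : CTHyp n R H W σ δ) (T : Finset ↥R) (hT : T.Nonempty) (g : ↥R × ι → ℝ)
    (hg : ∀ j, j.1 ∉ T → g j = 0) (w : ↥R × ι → ℝ) (hw : w = wexp (ctw n R δ T hT) (H⁻¹ *ᵥ g)) :
    w ⬝ᵥ (H *ᵥ w) ≤ 4 / σ * (g ⬝ᵥ g) := by
  have hσ := h.pos
  have hv : H *ᵥ (H⁻¹ *ᵥ g) = g := mulVec_inv_mulVec hσ h.coercive g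
  have hwj : ∀ j, w j = Real.exp (ctw n R δ T hT j.1) * (H⁻¹ *ᵥ g) j := fun j => by rw [hw]; rfl
  have hE2P := energy_le_two_conjPairing H σ (fun j => ctw n R δ T hT j.1) h.coercive
    (fun w => by simpa only [cerr] using h.err T hT w) _ w hwj
  rw [hv] at hE2P
  have hposw := h.coercive w
  have hww := dot_self_nonneg w
  have hE0 : 0 ≤ w ⬝ᵥ (H *ᵥ w) := le_trans (mul_nonneg hσ.le hww) hposw
  have hG : ∑ j, (Real.exp (ctw n R δ T hT j.1) * g j) ^ 2 ≤ g ⬝ᵥ g := by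
    have := weightedSq_le_of_support (fun j : ↥R × ι => ctw n R δ T hT j.1) g (T ×ˢ Finset.univ) 0
      (supp_cyl g hg) (fun j hj => ctw_le_zero_of_mem h.nonneg T hT (Finset.mem_product.1 hj).1)
    rw [dot_self_eq_sum_sq]
    simpa using this
  have hP2 : (∑ j, w j * (Real.exp (ctw n R δ T hT j.1) * g j)) ^ 2 ≤ (g ⬝ᵥ g) / σ * (w ⬝ᵥ (H *ᵥ w)) := by
    calc (∑ j, w j * (Real.exp (ctw n R δ T hT j.1) * g j)) ^ 2
        ≤ (∑ j, w j ^ 2) * ∑ j, (Real.exp (ctw n R δ T hT j.1) * g j) ^ 2 :=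
          Finset.sum_mul_sq_le_sq_mul_sq _ _ _ |>.trans_eq (by simp only [sq])
      _ ≤ (w ⬝ᵥ w) * (g ⬝ᵥ g) := by
          rw [dot_self_eq_sum_sq w]
          exact mul_le_mul_of_nonneg_left hG (Finset.sum_nonneg fun j _ => sq_nonneg _)
      _ ≤ (w ⬝ᵥ (H *ᵥ w) / σ) * (g ⬝ᵥ g) := by
          refine mul_le_mul_of_nonneg_right ?_ (dot_self_nonneg g)
          rw [le_div_iff₀ hσ, mul_comm]; exact hposw
      _ = (g ⬝ᵥ g) / σ * (w ⬝ᵥ (H *ᵥ w)) := by ring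
  have hfin := le_four_mul_of_sq_le hE0 (by have := dot_self_nonneg g; positivity) hE2P hP2
  calc w ⬝ᵥ (H *ᵥ w) ≤ 4 * ((g ⬝ᵥ g) / σ) := hfin
    _ = 4 / σ * (g ⬝ᵥ g) := by ring

/-- **ENERGY BOUND, CASE B (source `D_ν^{η*}f'`, `supp f' ⊆ T × ι`)** — the pairing-form estimate that never sees
`‖D^{η*}f'‖ ∼ η^{-1}‖f'‖`: with `v = G D_ν^{η*} f'`, `w = e^{φ}v`: `⟨w, Hw⟩ ≤ 8(1 + 4δ²/σ)‖f'‖²`.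
[cite: CombesThomas1973, §II] [folklore] -/
theorem energyB (h : CTHyp n R H W σ δ) (T : Finset ↥R) (hT : T.Nonempty) (ν : Fin (d + 1))
    (f' : ↥R × ι → ℝ) (hf' : ∀ j, j.1 ∉ T → f' j = 0) (w : ↥R × ι → ℝ)
    (hw : w = wexp (ctw n R δ T hT) (H⁻¹ *ᵥ ((covDeriv n R W ν)ᵀ *ᵥ f'))) :
    w ⬝ᵥ (H *ᵥ w) ≤ 8 * (1 + 4 * δ ^ 2 / σ) * (f' ⬝ᵥ f') := by
  classical
  have hσ := h.pos
  set φ := ctw n R δ T hT with hφ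
  set D := covDeriv n R W ν with hDdef
  have hv : H *ᵥ (H⁻¹ *ᵥ (Dᵀ *ᵥ f')) = Dᵀ *ᵥ f' := mulVec_inv_mulVec hσ h.coercive _
  have hwj : ∀ j, w j = Real.exp (φ j.1) * (H⁻¹ *ᵥ (Dᵀ *ᵥ f')) j := fun j => by rw [hw]; rfl
  have hE2P := energy_le_two_conjPairing H σ (fun j => φ j.1) h.coercive
    (fun w => by simpa only [cerr] using h.err T hT w) _ w hwj
  rw [hv] at hE2P
  have hposw := h.coercive w
  have hww := dot_self_nonneg w
  have hE0 : 0 ≤ w ⬝ᵥ (H *ᵥ w) := le_trans (mul_nonneg hσ.le hww) hposw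
  -- the conjugated pairing as `Σ_{x∈T} ⟨f'(x), (D_ν e^{φ}w)(x)⟩`
  set u : ↥R × ι → ℝ := wexp φ w with hu
  have hPeq : ∑ j, w j * (Real.exp (φ j.1) * (Dᵀ *ᵥ f') j) = ∑ x ∈ T, fld f' x ⬝ᵥ fld (D *ᵥ u) x := by
    have h1 : ∑ j, w j * (Real.exp (φ j.1) * (Dᵀ *ᵥ f') j) = u ⬝ᵥ (Dᵀ *ᵥ f') := by
      simp only [dotProduct, hu, wexp_apply]
      exact Finset.sum_congr rfl fun j _ => by ring
    rw [h1, dot_transpose_mulVec, dotProduct_eq_sum_fld, ← Finset.sum_subset (Finset.subset_univ T)]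
    · exact Finset.sum_congr rfl fun x _ => dotProduct_comm _ _
    · intro x _ hx
      rw [fld_eq_zero_of_not_mem f' hf' hx, dotProduct_zero]
  rw [hPeq] at hE2P
  -- the weighted Leibniz rule on `T` (where `φ ≤ 0`)
  have hUx : ∀ x ∈ T, fld (D *ᵥ u) x ⬝ᵥ fld (D *ᵥ u) x
      ≤ 2 * (fld (D *ᵥ w) x ⬝ᵥ fld (D *ᵥ w) x + 4 * δ ^ 2 * (shft w ν x ⬝ᵥ shft w ν x)) := by
    intro x hx
    have h1 := covLeibniz_sq_le h.one_le h.orth ν h.le_one φ (fun y hy => ctw_bond_le h.nonneg T hT ν y hy) w x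
    have h2 : Real.exp (φ x) ^ 2 ≤ 1 := by
      have he : Real.exp (φ x) ≤ 1 := Real.exp_le_one_iff.2 (ctw_le_zero_of_mem (n := n) h.nonneg T hT hx)
      have h0 := (Real.exp_pos (φ x)).le
      nlinarith
    have h3 : 0 ≤ fld (D *ᵥ w) x ⬝ᵥ fld (D *ᵥ w) x + 4 * δ ^ 2 * (shft w ν x ⬝ᵥ shft w ν x) := by
      have := dotProduct_self_nonneg' (fld (D *ᵥ w) x); have := dotProduct_self_nonneg' (shft w ν x); positivity
    calc _ ≤ _ := h1
      _ ≤ 2 * 1 * (fld (D *ᵥ w) x ⬝ᵥ fld (D *ᵥ w) x + 4 * δ ^ 2 * (shft w ν x ⬝ᵥ shft w ν x)) := by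
          refine mul_le_mul_of_nonneg_right (mul_le_mul_of_nonneg_left h2 (by norm_num)) h3
      _ = _ := by ring
  have hDw : ∑ x, fld (D *ᵥ w) x ⬝ᵥ fld (D *ᵥ w) x ≤ w ⬝ᵥ (H *ᵥ w) := by
    rw [← dotProduct_eq_sum_fld]; exact h.deriv ν w
  have hDT : ∑ x ∈ T, fld (D *ᵥ w) x ⬝ᵥ fld (D *ᵥ w) x ≤ ∑ x, fld (D *ᵥ w) x ⬝ᵥ fld (D *ᵥ w) x :=
    Finset.sum_le_sum_of_subset_of_nonneg (Finset.subset_univ T) fun x _ _ => dotProduct_self_nonneg' _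
  have hshift : ∑ x ∈ T, shft w ν x ⬝ᵥ shft w ν x ≤ w ⬝ᵥ w := sum_shft_sq_le w ν T
  have hwwE : w ⬝ᵥ w ≤ w ⬝ᵥ (H *ᵥ w) / σ := by
    rw [le_div_iff₀ hσ, mul_comm]; exact hposw
  have hU : ∑ x ∈ T, fld (D *ᵥ u) x ⬝ᵥ fld (D *ᵥ u) x ≤ 2 * (1 + 4 * δ ^ 2 / σ) * (w ⬝ᵥ (H *ᵥ w)) := by
    calc ∑ x ∈ T, fld (D *ᵥ u) x ⬝ᵥ fld (D *ᵥ u) x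
        ≤ ∑ x ∈ T, 2 * (fld (D *ᵥ w) x ⬝ᵥ fld (D *ᵥ w) x + 4 * δ ^ 2 * (shft w ν x ⬝ᵥ shft w ν x)) :=
          Finset.sum_le_sum hUx
      _ = 2 * ∑ x ∈ T, fld (D *ᵥ w) x ⬝ᵥ fld (D *ᵥ w) x + 8 * δ ^ 2 * ∑ x ∈ T, shft w ν x ⬝ᵥ shft w ν x := by
          rw [Finset.mul_sum, Finset.mul_sum, ← Finset.sum_add_distrib]
          exact Finset.sum_congr rfl fun x _ => by ring
      _ ≤ 2 * (w ⬝ᵥ (H *ᵥ w)) + 8 * δ ^ 2 * (w ⬝ᵥ (H *ᵥ w) / σ) :=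
          add_le_add (mul_le_mul_of_nonneg_left (hDT.trans hDw) (by norm_num))
            (mul_le_mul_of_nonneg_left (hshift.trans hwwE) (by positivity))
      _ = 2 * (1 + 4 * δ ^ 2 / σ) * (w ⬝ᵥ (H *ᵥ w)) := by ring
  have hP2 : (∑ x ∈ T, fld f' x ⬝ᵥ fld (D *ᵥ u) x) ^ 2
      ≤ 2 * (1 + 4 * δ ^ 2 / σ) * (f' ⬝ᵥ f') * (w ⬝ᵥ (H *ᵥ w)) := by
    have hf'T : ∑ x ∈ T, fld f' x ⬝ᵥ fld f' x ≤ f' ⬝ᵥ f' := by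
      rw [dotProduct_eq_sum_fld f' f']
      exact Finset.sum_le_sum_of_subset_of_nonneg (Finset.subset_univ T) fun x _ _ => dotProduct_self_nonneg' _
    calc (∑ x ∈ T, fld f' x ⬝ᵥ fld (D *ᵥ u) x) ^ 2
        ≤ (∑ x ∈ T, fld f' x ⬝ᵥ fld f' x) * ∑ x ∈ T, fld (D *ᵥ u) x ⬝ᵥ fld (D *ᵥ u) x := sq_sum_fld_dot_le T _ _
      _ ≤ (f' ⬝ᵥ f') * (2 * (1 + 4 * δ ^ 2 / σ) * (w ⬝ᵥ (H *ᵥ w))) :=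
          mul_le_mul hf'T hU (Finset.sum_nonneg fun x _ => dotProduct_self_nonneg' _) (dot_self_nonneg f')
      _ = 2 * (1 + 4 * δ ^ 2 / σ) * (f' ⬝ᵥ f') * (w ⬝ᵥ (H *ᵥ w)) := by ring
  have hfin := le_four_mul_of_sq_le hE0 (by have := dot_self_nonneg f'; positivity) hE2P hP2
  calc w ⬝ᵥ (H *ᵥ w) ≤ 4 * (2 * (1 + 4 * δ ^ 2 / σ) * (f' ⬝ᵥ f')) := hfin
    _ = 8 * (1 + 4 * δ ^ 2 / σ) * (f' ⬝ᵥ f') := by ring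

/-- **VALUES ON `S` FROM THE ENERGY**: `Σ_{x∈S} |v(x)|² ≤ e^{−2δρ}‖w‖² ≤ e^{−2δρ}⟨w,Hw⟩/σ` when `dist_η(S,T) ≥ ρ`.
[folklore] -/
theorem setSq_le_energy (h : CTHyp n R H W σ δ) (T : Finset ↥R) (hT : T.Nonempty) (S : Finset ↥R) (ρ : ℝ)
    (hρ : ∀ x ∈ S, ∀ t ∈ T, ρ ≤ edistR n R x t) (v w : ↥R × ι → ℝ) (hw : w = wexp (ctw n R δ T hT) v) :
    ∑ x ∈ S, fld v x ⬝ᵥ fld v x ≤ Real.exp (-(2 * (δ * ρ))) / σ * (w ⬝ᵥ (H *ᵥ w)) := by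
  have hσ := h.pos
  have h1 := setSq_le_of_weightedSq (fun j : ↥R × ι => ctw n R δ T hT j.1) v (S ×ˢ Finset.univ) (δ * ρ)
    (fun j hj => le_ctw h.nonneg T hT (fun t ht => hρ j.1 (Finset.mem_product.1 hj).1 t ht))
  have h2 : ∑ j, (Real.exp (ctw n R δ T hT j.1) * v j) ^ 2 = w ⬝ᵥ w := by rw [hw, wexp_dot_self]
  rw [h2] at h1
  have h3 : ∑ x ∈ S, fld v x ⬝ᵥ fld v x = ∑ i ∈ S ×ˢ (Finset.univ : Finset ι), v i ^ 2 := by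
    rw [sum_fld_dot_eq]; simp only [sq]
  rw [h3]
  have hwwE : w ⬝ᵥ w ≤ w ⬝ᵥ (H *ᵥ w) / σ := by
    rw [le_div_iff₀ hσ, mul_comm]; exact h.coercive w
  calc ∑ i ∈ S ×ˢ (Finset.univ : Finset ι), v i ^ 2 ≤ Real.exp (-(2 * (δ * ρ))) * (w ⬝ᵥ w) := h1
    _ ≤ Real.exp (-(2 * (δ * ρ))) * (w ⬝ᵥ (H *ᵥ w) / σ) := mul_le_mul_of_nonneg_left hwwE (Real.exp_pos _).le
    _ = Real.exp (-(2 * (δ * ρ))) / σ * (w ⬝ᵥ (H *ᵥ w)) := by ring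

/-- **COVARIANT GRADIENTS ON `S` FROM THE ENERGY**: `Σ_{x∈S} |(D^η_{W,μ}v)(x)|² ≤ 2e^{−2δρ}(1 + 4δ²/σ)⟨w,Hw⟩` when
`dist_η(S,T) ≥ ρ` (weighted covariant Leibniz + `‖D_μ w‖² ≤ ⟨w,Hw⟩`). [folklore] -/
theorem setDSq_le_energy (h : CTHyp n R H W σ δ) (T : Finset ↥R) (hT : T.Nonempty) (S : Finset ↥R) (ρ : ℝ)
    (hρ : ∀ x ∈ S, ∀ t ∈ T, ρ ≤ edistR n R x t) (v w : ↥R × ι → ℝ) (hw : w = wexp (ctw n R δ T hT) v)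
    (μ : Fin (d + 1)) :
    ∑ x ∈ S, fld (covDeriv n R W μ *ᵥ v) x ⬝ᵥ fld (covDeriv n R W μ *ᵥ v) x
      ≤ 2 * Real.exp (-(2 * (δ * ρ))) * (1 + 4 * δ ^ 2 / σ) * (w ⬝ᵥ (H *ᵥ w)) := by
  classical
  have hσ := h.pos
  set φ := ctw n R δ T hT with hφ
  set D := covDeriv n R W μ with hDdef
  have hv : v = wexp (fun x => -φ x) w := by rw [hw, wexp_neg_wexp]
  have hψ : ∀ (x : ↥R) (hx : x.1 + e1 μ ∈ R), |(fun y => -φ y) ⟨x.1 + e1 μ, hx⟩ - (fun y => -φ y) x| ≤ δ / (n : ℝ) := by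
    intro x hx
    have hb := ctw_bond_le (n := n) h.nonneg T hT μ x hx
    rw [abs_sub_comm] at hb
    simpa only [neg_sub_neg] using hb
  have hx : ∀ x ∈ S, fld (D *ᵥ v) x ⬝ᵥ fld (D *ᵥ v) x ≤ Real.exp (-(2 * (δ * ρ)))
      * (2 * (fld (D *ᵥ w) x ⬝ᵥ fld (D *ᵥ w) x + 4 * δ ^ 2 * (shft w μ x ⬝ᵥ shft w μ x))) := by
    intro x hxS
    have h1 := covLeibniz_sq_le h.one_le h.orth μ h.le_one (fun y => -φ y) hψ w x
    rw [← hv] at h1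
    have hlo : δ * ρ ≤ φ x := le_ctw h.nonneg T hT (fun t ht => hρ x hxS t ht)
    have h2 : Real.exp (-φ x) ^ 2 ≤ Real.exp (-(2 * (δ * ρ))) := by
      rw [← Real.exp_nat_mul]; push_cast
      exact Real.exp_le_exp.2 (by linarith)
    have h3 : 0 ≤ fld (D *ᵥ w) x ⬝ᵥ fld (D *ᵥ w) x + 4 * δ ^ 2 * (shft w μ x ⬝ᵥ shft w μ x) := by
      have := dotProduct_self_nonneg' (fld (D *ᵥ w) x); have := dotProduct_self_nonneg' (shft w μ x); positivity
    calc _ ≤ _ := h1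
      _ ≤ 2 * Real.exp (-(2 * (δ * ρ)))
            * (fld (D *ᵥ w) x ⬝ᵥ fld (D *ᵥ w) x + 4 * δ ^ 2 * (shft w μ x ⬝ᵥ shft w μ x)) :=
          mul_le_mul_of_nonneg_right (mul_le_mul_of_nonneg_left h2 (by norm_num)) h3
      _ = _ := by ring
  have hDw : ∑ x, fld (D *ᵥ w) x ⬝ᵥ fld (D *ᵥ w) x ≤ w ⬝ᵥ (H *ᵥ w) := by
    rw [← dotProduct_eq_sum_fld]; exact h.deriv μ w
  have hDS : ∑ x ∈ S, fld (D *ᵥ w) x ⬝ᵥ fld (D *ᵥ w) x ≤ ∑ x, fld (D *ᵥ w) x ⬝ᵥ fld (D *ᵥ w) x :=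
    Finset.sum_le_sum_of_subset_of_nonneg (Finset.subset_univ S) fun x _ _ => dotProduct_self_nonneg' _
  have hshift : ∑ x ∈ S, shft w μ x ⬝ᵥ shft w μ x ≤ w ⬝ᵥ w := sum_shft_sq_le w μ S
  have hwwE : w ⬝ᵥ w ≤ w ⬝ᵥ (H *ᵥ w) / σ := by
    rw [le_div_iff₀ hσ, mul_comm]; exact h.coercive w
  calc ∑ x ∈ S, fld (D *ᵥ v) x ⬝ᵥ fld (D *ᵥ v) x
      ≤ ∑ x ∈ S, Real.exp (-(2 * (δ * ρ)))
          * (2 * (fld (D *ᵥ w) x ⬝ᵥ fld (D *ᵥ w) x + 4 * δ ^ 2 * (shft w μ x ⬝ᵥ shft w μ x))) :=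
        Finset.sum_le_sum hx
    _ = 2 * Real.exp (-(2 * (δ * ρ))) * ∑ x ∈ S, fld (D *ᵥ w) x ⬝ᵥ fld (D *ᵥ w) x
          + 8 * δ ^ 2 * Real.exp (-(2 * (δ * ρ))) * ∑ x ∈ S, shft w μ x ⬝ᵥ shft w μ x := by
        rw [Finset.mul_sum, Finset.mul_sum, ← Finset.sum_add_distrib]
        exact Finset.sum_congr rfl fun x _ => by ring
    _ ≤ 2 * Real.exp (-(2 * (δ * ρ))) * (w ⬝ᵥ (H *ᵥ w))
          + 8 * δ ^ 2 * Real.exp (-(2 * (δ * ρ))) * (w ⬝ᵥ (H *ᵥ w) / σ) :=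
        add_le_add (mul_le_mul_of_nonneg_left (hDS.trans hDw) (by positivity))
          (mul_le_mul_of_nonneg_left (hshift.trans hwwE) (by positivity))
    _ = 2 * Real.exp (-(2 * (δ * ρ))) * (1 + 4 * δ ^ 2 / σ) * (w ⬝ᵥ (H *ᵥ w)) := by ring

/-- **SET-TO-SET DECAY OF `G = H⁻¹`**: `Σ_{x∈S} |(Gg)(x)|² ≤ (2/σ)² e^{−2δρ} ‖g‖²` for `supp g ⊆ T × ι`,
`dist_η(S,T) ≥ ρ`. [cite: CombesThomas1973, §II] [folklore] -/
theorem green_setDecay (h : CTHyp n R H W σ δ) (S T : Finset ↥R) (ρ : ℝ)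
    (hρ : ∀ x ∈ S, ∀ t ∈ T, ρ ≤ edistR n R x t) (g : ↥R × ι → ℝ) (hg : ∀ j, j.1 ∉ T → g j = 0) :
    ∑ x ∈ S, fld (H⁻¹ *ᵥ g) x ⬝ᵥ fld (H⁻¹ *ᵥ g) x
      ≤ (2 / σ) ^ 2 * Real.exp (-(2 * (δ * ρ))) * (g ⬝ᵥ g) := by
  have hσ := h.pos
  by_cases hT : T.Nonempty
  · set v := H⁻¹ *ᵥ g with hv
    set w : ↥R × ι → ℝ := wexp (ctw n R δ T hT) v with hw
    have hE := energyA h T hT g hg w rfl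
    have hS := setSq_le_energy h T hT S ρ hρ v w rfl
    calc ∑ x ∈ S, fld v x ⬝ᵥ fld v x ≤ Real.exp (-(2 * (δ * ρ))) / σ * (w ⬝ᵥ (H *ᵥ w)) := hS
      _ ≤ Real.exp (-(2 * (δ * ρ))) / σ * (4 / σ * (g ⬝ᵥ g)) := mul_le_mul_of_nonneg_left hE (by positivity)
      _ = (2 / σ) ^ 2 * Real.exp (-(2 * (δ * ρ))) * (g ⬝ᵥ g) := by ring
  · have hg0 := eq_zero_of_supp_empty hT g hg
    rw [hg0, Matrix.mulVec_zero]
    simp only [fld_zero, dotProduct_zero, Finset.sum_const_zero, mul_zero, le_refl]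

/-- **SET-TO-SET DECAY OF `D^η_{W,μ}G`**: `Σ_{x∈S} |(D_μGg)(x)|² ≤ (8/σ)(1 + 4δ²/σ) e^{−2δρ} ‖g‖²`.
[cite: CombesThomas1973, §II] [folklore] -/
theorem dgreen_setDecay (h : CTHyp n R H W σ δ) (S T : Finset ↥R) (ρ : ℝ)
    (hρ : ∀ x ∈ S, ∀ t ∈ T, ρ ≤ edistR n R x t) (g : ↥R × ι → ℝ) (hg : ∀ j, j.1 ∉ T → g j = 0)
    (μ : Fin (d + 1)) :
    ∑ x ∈ S, fld (covDeriv n R W μ *ᵥ (H⁻¹ *ᵥ g)) x ⬝ᵥ fld (covDeriv n R W μ *ᵥ (H⁻¹ *ᵥ g)) x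
      ≤ 8 / σ * (1 + 4 * δ ^ 2 / σ) * Real.exp (-(2 * (δ * ρ))) * (g ⬝ᵥ g) := by
  have hσ := h.pos
  by_cases hT : T.Nonempty
  · set v := H⁻¹ *ᵥ g with hv
    set w : ↥R × ι → ℝ := wexp (ctw n R δ T hT) v with hw
    have hE := energyA h T hT g hg w rfl
    have hS := setDSq_le_energy h T hT S ρ hρ v w rfl μ
    calc _ ≤ 2 * Real.exp (-(2 * (δ * ρ))) * (1 + 4 * δ ^ 2 / σ) * (w ⬝ᵥ (H *ᵥ w)) := hS
      _ ≤ 2 * Real.exp (-(2 * (δ * ρ))) * (1 + 4 * δ ^ 2 / σ) * (4 / σ * (g ⬝ᵥ g)) :=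
          mul_le_mul_of_nonneg_left hE (by positivity)
      _ = 8 / σ * (1 + 4 * δ ^ 2 / σ) * Real.exp (-(2 * (δ * ρ))) * (g ⬝ᵥ g) := by ring
  · have hg0 := eq_zero_of_supp_empty hT g hg
    rw [hg0, Matrix.mulVec_zero, Matrix.mulVec_zero]
    simp only [fld_zero, dotProduct_zero, Finset.sum_const_zero, mul_zero, le_refl]

/-- **SET-TO-SET DECAY OF `GD^{η*}_{W,ν}`**: `Σ_{x∈S} |(GD_ν^*f')(x)|² ≤ (8/σ)(1 + 4δ²/σ) e^{−2δρ} ‖f'‖²` for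
`supp f' ⊆ T × ι` — uniform in the mesh although `‖D^*f'‖₂ ∼ η^{-1}‖f'‖₂`. [cite: CombesThomas1973, §II] [folklore] -/
theorem greenT_setDecay (h : CTHyp n R H W σ δ) (S T : Finset ↥R) (ρ : ℝ)
    (hρ : ∀ x ∈ S, ∀ t ∈ T, ρ ≤ edistR n R x t) (ν : Fin (d + 1)) (f' : ↥R × ι → ℝ)
    (hf' : ∀ j, j.1 ∉ T → f' j = 0) :
    ∑ x ∈ S, fld (H⁻¹ *ᵥ ((covDeriv n R W ν)ᵀ *ᵥ f')) x ⬝ᵥ fld (H⁻¹ *ᵥ ((covDeriv n R W ν)ᵀ *ᵥ f')) x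
      ≤ 8 / σ * (1 + 4 * δ ^ 2 / σ) * Real.exp (-(2 * (δ * ρ))) * (f' ⬝ᵥ f') := by
  have hσ := h.pos
  by_cases hT : T.Nonempty
  · set v := H⁻¹ *ᵥ ((covDeriv n R W ν)ᵀ *ᵥ f') with hv
    set w : ↥R × ι → ℝ := wexp (ctw n R δ T hT) v with hw
    have hE := energyB h T hT ν f' hf' w rfl
    have hS := setSq_le_energy h T hT S ρ hρ v w rfl
    calc ∑ x ∈ S, fld v x ⬝ᵥ fld v x ≤ Real.exp (-(2 * (δ * ρ))) / σ * (w ⬝ᵥ (H *ᵥ w)) := hS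
      _ ≤ Real.exp (-(2 * (δ * ρ))) / σ * (8 * (1 + 4 * δ ^ 2 / σ) * (f' ⬝ᵥ f')) :=
          mul_le_mul_of_nonneg_left hE (by positivity)
      _ = 8 / σ * (1 + 4 * δ ^ 2 / σ) * Real.exp (-(2 * (δ * ρ))) * (f' ⬝ᵥ f') := by ring
  · have h0 := eq_zero_of_supp_empty hT f' hf'
    rw [h0, Matrix.mulVec_zero, Matrix.mulVec_zero]
    simp only [fld_zero, dotProduct_zero, Finset.sum_const_zero, mul_zero, le_refl]

/-- **SET-TO-SET DECAY OF `D^η_{W,μ}GD^{η*}_{W,ν}`**: `Σ_{x∈S} |(D_μGD_ν^*f')(x)|² ≤ 16(1 + 4δ²/σ)² e^{−2δρ} ‖f'‖²`.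
[cite: CombesThomas1973, §II] [folklore] -/
theorem dgreenT_setDecay (h : CTHyp n R H W σ δ) (S T : Finset ↥R) (ρ : ℝ)
    (hρ : ∀ x ∈ S, ∀ t ∈ T, ρ ≤ edistR n R x t) (μ ν : Fin (d + 1)) (f' : ↥R × ι → ℝ)
    (hf' : ∀ j, j.1 ∉ T → f' j = 0) :
    ∑ x ∈ S, fld (covDeriv n R W μ *ᵥ (H⁻¹ *ᵥ ((covDeriv n R W ν)ᵀ *ᵥ f'))) x
        ⬝ᵥ fld (covDeriv n R W μ *ᵥ (H⁻¹ *ᵥ ((covDeriv n R W ν)ᵀ *ᵥ f'))) x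
      ≤ 16 * (1 + 4 * δ ^ 2 / σ) ^ 2 * Real.exp (-(2 * (δ * ρ))) * (f' ⬝ᵥ f') := by
  have hσ := h.pos
  by_cases hT : T.Nonempty
  · set v := H⁻¹ *ᵥ ((covDeriv n R W ν)ᵀ *ᵥ f') with hv
    set w : ↥R × ι → ℝ := wexp (ctw n R δ T hT) v with hw
    have hE := energyB h T hT ν f' hf' w rfl
    have hS := setDSq_le_energy h T hT S ρ hρ v w rfl μ
    calc _ ≤ 2 * Real.exp (-(2 * (δ * ρ))) * (1 + 4 * δ ^ 2 / σ) * (w ⬝ᵥ (H *ᵥ w)) := hS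
      _ ≤ 2 * Real.exp (-(2 * (δ * ρ))) * (1 + 4 * δ ^ 2 / σ) * (8 * (1 + 4 * δ ^ 2 / σ) * (f' ⬝ᵥ f')) :=
          mul_le_mul_of_nonneg_left hE (by positivity)
      _ = 16 * (1 + 4 * δ ^ 2 / σ) ^ 2 * Real.exp (-(2 * (δ * ρ))) * (f' ⬝ᵥ f') := by ring
  · have h0 := eq_zero_of_supp_empty hT f' hf'
    rw [h0, Matrix.mulVec_zero, Matrix.mulVec_zero, Matrix.mulVec_zero]
    simp only [fld_zero, dotProduct_zero, Finset.sum_const_zero, mul_zero, le_refl]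

end Decay

/-! ## §E  The four pairings with one constant `c(σ)` -/

/-- **THE CONSTANT OF THE ABSTRACT STEP**: `c(σ) = 4(1 + 4/σ)(1 + 1/σ)` (depends on the coercivity constant only;
`B4Cor23Zero.c0 a = c(min(2,a))`). [folklore] -/
def cR (σ : ℝ) : ℝ := 4 * (1 + 4 / σ) * (1 + 1 / σ)

/-- the block `ℓ²` norm `‖f‖₂ = ⟨f,f⟩^{1/2}` of an `R^N`-valued configuration (counting normalisation; Bałaban's
`η^{d+1}`-weighted `‖·‖₂` is `η^{(d+1)/2}` times it, on both sides of (2.30)). [folklore] -/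
def bl2n {J : Type*} [Fintype J] (f : J → ℝ) : ℝ := Real.sqrt (f ⬝ᵥ f)

section Pairings

open Literature.MathematicalPhysics.QuantumFieldTheory.Balaban1983to89.B4Lower18 (edistR)
open Literature.MathematicalPhysics.QuantumFieldTheory.Balaban1983to89.B4Lemma21Region (covDeriv)

variable {d : ℕ} {ι : Type*} [Fintype ι] [DecidableEq ι] {n : ℕ} {R : Finset (Fin (d + 1) → ℤ)}
  {H : Matrix (↥R × ι) (↥R × ι) ℝ} {W : ↥R → ↥R → Matrix ι ι ℝ} {σ δ : ℝ}

/-- `c(σ) > 0`. [folklore] -/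
theorem cR_pos (hσ : 0 < σ) : 0 < cR σ := by unfold cR; positivity

/-- the three constants of §D are dominated by `c(σ)²` for `0 ≤ δ ≤ 1`. [folklore] -/
theorem consts_le_cR_sq (hσ : 0 < σ) (hδ0 : 0 ≤ δ) (hδ1 : δ ≤ 1) :
    (2 / σ) ^ 2 ≤ cR σ ^ 2 ∧ 8 / σ * (1 + 4 * δ ^ 2 / σ) ≤ cR σ ^ 2
      ∧ 16 * (1 + 4 * δ ^ 2 / σ) ^ 2 ≤ cR σ ^ 2 := by
  set s : ℝ := 1 / σ with hs
  have hs0 : 0 < s := by positivity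
  have hδ2 : δ ^ 2 ≤ 1 := by nlinarith
  have e1 : 2 / σ = 2 * s := by rw [hs]; ring
  have e2 : 8 / σ = 8 * s := by rw [hs]; ring
  have e3 : 4 * δ ^ 2 / σ = 4 * δ ^ 2 * s := by rw [hs]; ring
  have e4 : cR σ = 4 * (1 + 4 * s) * (1 + s) := by unfold cR; rw [hs]; ring
  have hA : 1 + 4 * δ ^ 2 * s ≤ 1 + 4 * s := by nlinarith
  have hA0 : 0 ≤ 1 + 4 * δ ^ 2 * s := by positivity
  rw [e1, e2, e3, e4]
  refine ⟨by nlinarith, ?_, ?_⟩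
  · calc 8 * s * (1 + 4 * δ ^ 2 * s) ≤ 8 * s * (1 + 4 * s) := mul_le_mul_of_nonneg_left hA (by positivity)
      _ ≤ 16 * (1 + 4 * s) ^ 2 * (1 + s) ^ 2 := by
          have h1 : 8 * s ≤ 16 * (1 + 4 * s) * (1 + s) ^ 2 := by nlinarith [sq_nonneg s]
          have h2 : 0 ≤ 1 + 4 * s := by positivity
          calc 8 * s * (1 + 4 * s) = (8 * s) * (1 + 4 * s) := by ring
            _ ≤ (16 * (1 + 4 * s) * (1 + s) ^ 2) * (1 + 4 * s) := mul_le_mul_of_nonneg_right h1 h2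
            _ = 16 * (1 + 4 * s) ^ 2 * (1 + s) ^ 2 := by ring
      _ = (4 * (1 + 4 * s) * (1 + s)) ^ 2 := by ring
  · calc 16 * (1 + 4 * δ ^ 2 * s) ^ 2 ≤ 16 * (1 + 4 * s) ^ 2 := by
          refine mul_le_mul_of_nonneg_left (pow_le_pow_left₀ hA0 hA 2) (by norm_num)
      _ = 16 * (1 + 4 * s) ^ 2 * 1 := by ring
      _ ≤ 16 * (1 + 4 * s) ^ 2 * (1 + s) ^ 2 :=
          mul_le_mul_of_nonneg_left (by nlinarith) (by positivity)
      _ = (4 * (1 + 4 * s) * (1 + s)) ^ 2 := by ring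

omit [DecidableEq ι] in
/-- **FROM A SET-TO-SET SQUARE BOUND TO A PAIRING BOUND** (Cauchy–Schwarz): if `supp f ⊆ S × ι` and
`Σ_{x∈S} |X(x)|² ≤ C²·B` then `|⟨f, X⟩| ≤ C‖f‖₂√B`. [folklore] -/
theorem abs_dot_le_of_setSq (f X : ↥R × ι → ℝ) (S : Finset ↥R) (hf : ∀ j, j.1 ∉ S → f j = 0) {C B : ℝ}
    (hC : 0 ≤ C) (hX : ∑ x ∈ S, fld X x ⬝ᵥ fld X x ≤ C ^ 2 * B) :
    |f ⬝ᵥ X| ≤ C * bl2n f * Real.sqrt B := by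
  classical
  have h1 : f ⬝ᵥ X = ∑ x ∈ S, fld f x ⬝ᵥ fld X x := by
    rw [dotProduct_eq_sum_fld, ← Finset.sum_subset (Finset.subset_univ S)]
    intro x _ hx
    rw [fld_eq_zero_of_not_mem f hf hx, zero_dotProduct]
  have hff : ∑ x ∈ S, fld f x ⬝ᵥ fld f x ≤ f ⬝ᵥ f := by
    rw [dotProduct_eq_sum_fld f f]
    exact Finset.sum_le_sum_of_subset_of_nonneg (Finset.subset_univ S) fun x _ _ => dotProduct_self_nonneg' _
  have h2 : (f ⬝ᵥ X) ^ 2 ≤ (f ⬝ᵥ f) * (C ^ 2 * B) := by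
    rw [h1]
    calc (∑ x ∈ S, fld f x ⬝ᵥ fld X x) ^ 2 ≤ (∑ x ∈ S, fld f x ⬝ᵥ fld f x) * ∑ x ∈ S, fld X x ⬝ᵥ fld X x :=
          sq_sum_fld_dot_le S f X
      _ ≤ (f ⬝ᵥ f) * (C ^ 2 * B) :=
          mul_le_mul hff hX (Finset.sum_nonneg fun x _ => dotProduct_self_nonneg' _) (dot_self_nonneg f)
  have h3 : |f ⬝ᵥ X| = Real.sqrt ((f ⬝ᵥ X) ^ 2) := (Real.sqrt_sq_eq_abs _).symm
  rw [h3]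
  calc Real.sqrt ((f ⬝ᵥ X) ^ 2) ≤ Real.sqrt ((f ⬝ᵥ f) * (C ^ 2 * B)) := Real.sqrt_le_sqrt h2
    _ = Real.sqrt (f ⬝ᵥ f) * (Real.sqrt (C ^ 2) * Real.sqrt B) := by
        rw [Real.sqrt_mul (dot_self_nonneg f), Real.sqrt_mul (sq_nonneg C)]
    _ = C * bl2n f * Real.sqrt B := by rw [Real.sqrt_sq hC, bl2n]; ring

/-- **THE FOUR PAIRINGS OF (2.30), ABSTRACT STEP, in set form**: under `CTHyp n R H W σ δ`, for `supp f ⊆ S × ι`,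
`supp f' ⊆ T × ι`, `dist_η(S,T) ≥ ρ`, `G = H⁻¹`, `D_μ = D^η_{W,μ}`:
`|⟨f, Gf'⟩|, |⟨f, D_μGf'⟩|, |⟨f, GD_ν^*f'⟩|, |⟨f, D_μGD_ν^*f'⟩| ≤ c(σ) e^{−δρ} ‖f‖₂‖f'‖₂`.
[cite: CombesThomas1973, §II] [folklore] -/
theorem pairings_set (h : CTHyp n R H W σ δ) (S T : Finset ↥R) (ρ : ℝ)
    (hρ : ∀ x ∈ S, ∀ t ∈ T, ρ ≤ edistR n R x t) (f f' : ↥R × ι → ℝ) (hf : ∀ j, j.1 ∉ S → f j = 0)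
    (hf' : ∀ j, j.1 ∉ T → f' j = 0) (μ ν : Fin (d + 1)) :
    |f ⬝ᵥ (H⁻¹ *ᵥ f')| ≤ cR σ * Real.exp (-(δ * ρ)) * bl2n f * bl2n f'
    ∧ |f ⬝ᵥ (covDeriv n R W μ *ᵥ (H⁻¹ *ᵥ f'))| ≤ cR σ * Real.exp (-(δ * ρ)) * bl2n f * bl2n f'
    ∧ |f ⬝ᵥ (H⁻¹ *ᵥ ((covDeriv n R W ν)ᵀ *ᵥ f'))| ≤ cR σ * Real.exp (-(δ * ρ)) * bl2n f * bl2n f'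
    ∧ |f ⬝ᵥ (covDeriv n R W μ *ᵥ (H⁻¹ *ᵥ ((covDeriv n R W ν)ᵀ *ᵥ f')))|
        ≤ cR σ * Real.exp (-(δ * ρ)) * bl2n f * bl2n f' := by
  have hσ := h.pos
  obtain ⟨k1, k2, k3⟩ := consts_le_cR_sq hσ h.nonneg h.le_one
  have hc : 0 ≤ cR σ * Real.exp (-(δ * ρ)) := (mul_pos (cR_pos hσ) (Real.exp_pos _)).le
  have hB : 0 ≤ f' ⬝ᵥ f' := dot_self_nonneg f'
  have hexp : Real.exp (-(2 * (δ * ρ))) = Real.exp (-(δ * ρ)) ^ 2 := by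
    rw [← Real.exp_nat_mul]; push_cast; ring_nf
  have hCsq : (cR σ * Real.exp (-(δ * ρ))) ^ 2 = cR σ ^ 2 * Real.exp (-(2 * (δ * ρ))) := by rw [hexp]; ring
  have he0 : 0 ≤ Real.exp (-(2 * (δ * ρ))) := (Real.exp_pos _).le
  have hl2 : bl2n f' = Real.sqrt (f' ⬝ᵥ f') := rfl
  have conv : ∀ {K : ℝ} {X : ↥R × ι → ℝ}, K ≤ cR σ ^ 2 →
      ∑ x ∈ S, fld X x ⬝ᵥ fld X x ≤ K * Real.exp (-(2 * (δ * ρ))) * (f' ⬝ᵥ f') →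
      |f ⬝ᵥ X| ≤ cR σ * Real.exp (-(δ * ρ)) * bl2n f * bl2n f' := by
    intro K X hK hX
    have hX' : ∑ x ∈ S, fld X x ⬝ᵥ fld X x ≤ (cR σ * Real.exp (-(δ * ρ))) ^ 2 * (f' ⬝ᵥ f') := by
      rw [hCsq]
      exact hX.trans (mul_le_mul_of_nonneg_right (mul_le_mul_of_nonneg_right hK he0) hB)
    rw [hl2]
    exact abs_dot_le_of_setSq f X S hf hc hX'
  exact ⟨conv k1 (green_setDecay h S T ρ hρ f' hf'),
    conv k2 (dgreen_setDecay h S T ρ hρ f' hf' μ),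
    conv k2 (greenT_setDecay h S T ρ hρ ν f' hf'),
    conv k3 (dgreenT_setDecay h S T ρ hρ μ ν f' hf')⟩

end Pairings

/-! ## §F  Corollary 2.3 (2.30), `G_k(Ω,A)` clause, AT `A ≠ 0`: [B4]'s region operator under the printed regularity
(1.7) and «e sufficiently small»; the explicit `c₀(a)`, `δ₀(d,a)`; the printed quantifier shape -/

/-- **THE CONSTANT `c₀` OF (2.30) AT `A ≠ 0`, EXPLICIT**: `c₀(a) = c(min(2,a)/4) = 4(1 + 16/min(2,a))(1 + 4/min(2,a))`
— depends on `a` only (not on `d`, the mesh, the mass, the region, the field or the charge).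
[cite: Balaban1983RegularityDecay, p. 580 (2.30)] -/
def c0R (a : ℝ) : ℝ := cR (min 2 a / 4)

/-- **THE RATE `δ₀` OF (2.30) AT `A ≠ 0`, EXPLICIT**: `δ₀(d,a) = min(2,a)/(16(d+1+a))`.
[cite: Balaban1983RegularityDecay, p. 580 (2.30)] -/
def delta0R (d : ℕ) (a : ℝ) : ℝ := min 2 a / (16 * ((d : ℝ) + 1 + a))

section Printed

open Literature.MathematicalPhysics.QuantumFieldTheory.Balaban1983to89.B4Lower18
  (fineDom mem_fineDom edistR)
open Literature.MathematicalPhysics.QuantumFieldTheory.Balaban1983to89.B4Lower18Regular (threshold_exists rot_lipschitz)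
open Literature.MathematicalPhysics.QuantumFieldTheory.Balaban1983to89.B4Lower18RegularRegion (compField)
open Literature.MathematicalPhysics.QuantumFieldTheory.Balaban1983to89.B4Lemma21Region
  (covDeriv regionOp regionDeriv regionOp_form_ge regionDeriv_sq_le_form)
open Literature.MathematicalPhysics.QuantumFieldTheory.Balaban1983to89.B4Cor23Zero (ctw abs_ctw_sub_le edistR_nonneg)

variable {d : ℕ} {ι : Type*} [Fintype ι] [DecidableEq ι] {R : Finset (Fin (d + 1) → ℤ)}

/-- `c₀(a) = 4(1 + 16/min(2,a))(1 + 4/min(2,a))`. [folklore] -/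
theorem c0R_eq (a : ℝ) : c0R a = 4 * (1 + 16 / min 2 a) * (1 + 4 / min 2 a) := by
  unfold c0R cR
  rw [div_div_eq_mul_div, div_div_eq_mul_div]
  ring

/-- `c₀(a) > 0`. [folklore] -/
theorem c0R_pos {a : ℝ} (ha : 0 < a) : 0 < c0R a := cR_pos (div_pos (lt_min two_pos ha) four_pos)

/-- `δ₀(d,a) > 0`. [folklore] -/
theorem delta0R_pos (d : ℕ) {a : ℝ} (ha : 0 < a) : 0 < delta0R d a := by
  unfold delta0R
  have := lt_min (two_pos : (0 : ℝ) < 2) ha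
  positivity

/-- **THE EXPLICIT RATE IS ADMISSIBLE**: `0 ≤ δ₀ ≤ 1` and the `η`-free Combes–Thomas smallness
`2(d+1)δ₀² + a(e^{δ₀} − 1) ≤ min(2,a)/8 = σ/2` for `σ = min(2,a)/4` (via `e^δ − 1 ≤ δ + δ²`, `δ ≤ 1`). [folklore] -/
theorem delta0R_admissible (d : ℕ) {a : ℝ} (ha : 0 < a) :
    0 ≤ delta0R d a ∧ delta0R d a ≤ 1
      ∧ 2 * ((d : ℝ) + 1) * delta0R d a ^ 2 + a * (Real.exp (delta0R d a) - 1) ≤ min 2 a / 8 := by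
  have hσ : 0 < min 2 a := lt_min (by norm_num) ha
  have hσ2 : min 2 a ≤ 2 := min_le_left _ _
  have hD : 0 < (d : ℝ) + 1 + a := by positivity
  set δ := delta0R d a with hδ
  have hδ0 : 0 ≤ δ := (delta0R_pos d ha).le
  have hkey : 16 * ((d : ℝ) + 1 + a) * δ = min 2 a := by
    rw [hδ]; unfold delta0R; field_simp
  have hd0 : (0 : ℝ) ≤ d := Nat.cast_nonneg d
  have hδ1 : δ ≤ 1 := by nlinarith
  refine ⟨hδ0, hδ1, ?_⟩
  have h1 : |Real.exp δ - 1 - δ| ≤ δ ^ 2 := Real.abs_exp_sub_one_sub_id_le (by rw [abs_of_nonneg hδ0]; exact hδ1)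
  have h2 : Real.exp δ - 1 ≤ δ + δ ^ 2 := by linarith [(abs_le.1 h1).2]
  have h3 : δ ^ 2 ≤ δ := by nlinarith
  calc 2 * ((d : ℝ) + 1) * δ ^ 2 + a * (Real.exp δ - 1)
      ≤ 2 * ((d : ℝ) + 1) * δ + a * (δ + δ) := by
        have := mul_le_mul_of_nonneg_left h2 ha.le
        nlinarith
    _ = (16 * ((d : ℝ) + 1 + a) * δ) / 8 := by ring
    _ = min 2 a / 8 := by rw [hkey]

/-- the support of an `R^N`-valued configuration: the sites where some component is non-zero. [folklore] -/
def bsupp (f : ↥R × ι → ℝ) : Finset ↥R := Finset.univ.filter fun x => fld f x ≠ 0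

omit [DecidableEq ι] in
/-- off its support a configuration vanishes. [folklore] -/
theorem eq_zero_of_not_mem_bsupp (f : ↥R × ι → ℝ) (j : ↥R × ι) (hj : j.1 ∉ bsupp f) : f j = 0 := by
  by_contra hne
  refine hj (Finset.mem_filter.2 ⟨Finset.mem_univ _, fun h0 => hne ?_⟩)
  have := congrFun h0 j.2
  simpa only [fld_apply, Pi.zero_apply] using this

/-- `dist_η(supp f, supp f')` in the `η`-scaled sup-norm (and `0` if a support is empty). [folklore] -/
def bsuppDist (n : ℕ) (R : Finset (Fin (d + 1) → ℤ)) (f f' : ↥R × ι → ℝ) : ℝ :=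
  if h : (bsupp f ×ˢ bsupp f').Nonempty then (bsupp f ×ˢ bsupp f').inf' h (fun p => edistR n R p.1 p.2) else 0

omit [DecidableEq ι] in
/-- `dist_η(supp f, supp f') ≤ dist_η(x,t)` for `x ∈ supp f`, `t ∈ supp f'`. [folklore] -/
theorem bsuppDist_le {n : ℕ} (f f' : ↥R × ι → ℝ) {x t : ↥R} (hx : x ∈ bsupp f) (ht : t ∈ bsupp f') :
    bsuppDist n R f f' ≤ edistR n R x t := by
  have hmem : (x, t) ∈ bsupp f ×ˢ bsupp f' := Finset.mk_mem_product hx ht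
  have hne : (bsupp f ×ˢ bsupp f').Nonempty := ⟨(x, t), hmem⟩
  unfold bsuppDist
  rw [dif_pos hne]
  exact Finset.inf'_le (fun p : ↥R × ↥R => edistR n R p.1 p.2) hmem

omit [DecidableEq ι] in
/-- `dist_η(supp f, supp f') ≥ 0`. [folklore] -/
theorem bsuppDist_nonneg {n : ℕ} (f f' : ↥R × ι → ℝ) : 0 ≤ bsuppDist n R f f' := by
  unfold bsuppDist
  split_ifs with h
  · exact Finset.le_inf' h _ fun p _ => edistR_nonneg p.1 p.2
  · exact le_rfl

variable (F : OrthFlow ι) {ℓ : ℝ} (hℓ : 0 ≤ ℓ)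
  (hLip : ∀ t (v : ι → ℝ), ((F.U t - 1) *ᵥ v) ⬝ᵥ ((F.U t - 1) *ᵥ v) ≤ (ℓ * t) ^ 2 * (v ⬝ᵥ v))
  {e : ℝ} (he : 0 < e) {n : ℕ} (hn : 1 ≤ n) {a : ℝ} (ha : 0 < a) {m2 : ℝ} (hm : 0 ≤ m2)
  (Ωc : Finset (Fin (d + 1) → ℤ)) {Ac : (Fin (d + 1) → ℤ) → Fin (d + 1) → ℝ} {c β : ℝ} (hc : 0 ≤ c)
  (h17 : ∀ x ∈ fineDom n Ωc, ∀ μ ν : Fin (d + 1), |Ac (x + e1 μ) ν - Ac x ν| ≤ c * e ^ (β - 1) / n)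
  (hsmall : ℓ ^ 2 * ((d + 1) * c * e ^ β) ^ 2 * (d + 1) * (1 + a * (d + 1)) ≤ min 2 a / 4)

include hℓ hLip he ha hm hc h17 hsmall

/-- **THE HYPOTHESES OF THE ABSTRACT STEP HOLD FOR [B4]'s REGION OPERATOR AT `A ≠ 0`** with `σ = min(2,a)/4` and any
`0 ≤ δ ≤ 1` with `2(d+1)δ² + a(e^δ − 1) ≤ min(2,a)/8`: coercivity = (1.8) on the region (`B4Lemma21Region.regionOp_form_ge`,
under (1.7) and the smallness of `e`), `‖D^η_{A,μ}Φ‖² ≤ ⟨Φ,HΦ⟩` = (2.29) (`regionDeriv_sq_le_form`), orthogonality of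
`U(eηA_b)`, and the conjugation-error bound of §B. [cite: Balaban1983RegularityDecay, p. 573 (1.8), p. 580 (2.29)] -/
theorem ctHyp_region {δ : ℝ} (hδ0 : 0 ≤ δ) (hδ1 : δ ≤ 1)
    (hct : 2 * ((d : ℝ) + 1) * δ ^ 2 + a * (Real.exp δ - 1) ≤ min 2 a / 8) :
    CTHyp n (fineDom n Ωc) (regionOp F e hn a m2 Ωc Ac)
      (fieldLink F (e / n) fun u v : ↥(fineDom n Ωc) => compField Ac u.1 v.1) (min 2 a / 4) δ where
  one_le := hn
  pos := div_pos (lt_min two_pos ha) four_pos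
  coercive Φ := by
    have h1 := regionOp_form_ge F hℓ hLip he hn ha Ωc hc h17 hsmall Φ (m2 := m2)
    have h2 := dot_self_nonneg Φ
    nlinarith
  deriv μ Φ := regionDeriv_sq_le_form F e hn ha.le hm Ωc Ac μ Φ
  orth x y := F.orth _
  nonneg := hδ0
  le_one := hδ1
  err T hT w := by
    have h := cerr_regionOp_ge F e hn ha.le m2 Ωc Ac hδ0 hδ1 (ctw n (fineDom n Ωc) δ T hT)
      (fun x y => abs_ctw_sub_le hδ0 T hT x y) w
    have hww := dot_self_nonneg w
    nlinarith

/-- **B4 COROLLARY 2.3 (2.30) AT `A ≠ 0` — THE FOUR PAIRINGS, `η`-UNIFORM, WITH MASS, ON EVERY FINITE UNION OF UNIT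
BLOCKS, in set form**: under (1.7) and the smallness of `e`, for `a > 0`, `m² ≥ 0`, `0 ≤ δ ≤ 1` with
`2(d+1)δ² + a(e^δ − 1) ≤ min(2,a)/8`, `supp f ⊆ S × R^N`, `supp f' ⊆ T × R^N`, `dist_η(S,T) ≥ ρ`, `G = G_k(Ω,A)`,
`D_μ = D^η_{A,μ}`:  `|⟨f, Gf'⟩|, |⟨f, D_μGf'⟩|, |⟨f, GD_ν^*f'⟩|, |⟨f, D_μGD_ν^*f'⟩| ≤ c₀(a) e^{−δρ} ‖f‖₂‖f'‖₂`.
[cite: Balaban1983RegularityDecay, p. 580–581 Corollary 2.3 (2.30)] -/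
theorem cor23_pairings_set_region {δ : ℝ} (hδ0 : 0 ≤ δ) (hδ1 : δ ≤ 1)
    (hct : 2 * ((d : ℝ) + 1) * δ ^ 2 + a * (Real.exp δ - 1) ≤ min 2 a / 8)
    (S T : Finset ↥(fineDom n Ωc)) (ρ : ℝ) (hρ : ∀ x ∈ S, ∀ t ∈ T, ρ ≤ edistR n (fineDom n Ωc) x t)
    (f f' : ↥(fineDom n Ωc) × ι → ℝ) (hf : ∀ j, j.1 ∉ S → f j = 0) (hf' : ∀ j, j.1 ∉ T → f' j = 0)
    (μ ν : Fin (d + 1)) :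
    |f ⬝ᵥ ((regionOp F e hn a m2 Ωc Ac)⁻¹ *ᵥ f')| ≤ c0R a * Real.exp (-(δ * ρ)) * bl2n f * bl2n f'
    ∧ |f ⬝ᵥ (regionDeriv F e n Ωc Ac μ *ᵥ ((regionOp F e hn a m2 Ωc Ac)⁻¹ *ᵥ f'))|
        ≤ c0R a * Real.exp (-(δ * ρ)) * bl2n f * bl2n f'
    ∧ |f ⬝ᵥ ((regionOp F e hn a m2 Ωc Ac)⁻¹ *ᵥ ((regionDeriv F e n Ωc Ac ν)ᵀ *ᵥ f'))|
        ≤ c0R a * Real.exp (-(δ * ρ)) * bl2n f * bl2n f'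
    ∧ |f ⬝ᵥ (regionDeriv F e n Ωc Ac μ *ᵥ
          ((regionOp F e hn a m2 Ωc Ac)⁻¹ *ᵥ ((regionDeriv F e n Ωc Ac ν)ᵀ *ᵥ f')))|
        ≤ c0R a * Real.exp (-(δ * ρ)) * bl2n f * bl2n f' :=
  pairings_set (ctHyp_region F hℓ hLip he hn ha hm Ωc hc h17 hsmall hδ0 hδ1 hct) S T ρ hρ f f' hf hf' μ ν

/-- **B4 COROLLARY 2.3 (2.30) AT `A ≠ 0`, PRINTED SHAPE OF THE SUPPORTS** — «for arbitrary … field configurations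
f, f' defined on Ω … |⟨f, G_k(Ω,A)f'⟩|, |⟨f, D^η_{A,μ}G_k(Ω,A)f'⟩|, |⟨f, G_k(Ω,A)D^{η*}_{A,ν}f'⟩|,
|⟨f, D^η_{A,μ}G_k(Ω,A)D^{η*}_{A,ν}f'⟩| ≤ c₀e^{−δ₀dist(supp f,supp f')}‖f‖₂‖f'‖₂»: under (1.7) and the smallness of `e`,
with the EXPLICIT `c₀(a)`, `δ₀(d,a)`, for EVERY mesh, EVERY finite union `Ω` of unit blocks, EVERY mass `m² ≥ 0` and
EVERY pair of `R^N`-valued `f, f'`. [cite: Balaban1983RegularityDecay, p. 580–581 Corollary 2.3 (2.30)] -/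
theorem cor23_main_region (f f' : ↥(fineDom n Ωc) × ι → ℝ) (μ ν : Fin (d + 1)) :
    |f ⬝ᵥ ((regionOp F e hn a m2 Ωc Ac)⁻¹ *ᵥ f')|
        ≤ c0R a * Real.exp (-(delta0R d a * bsuppDist n (fineDom n Ωc) f f')) * bl2n f * bl2n f'
    ∧ |f ⬝ᵥ (regionDeriv F e n Ωc Ac μ *ᵥ ((regionOp F e hn a m2 Ωc Ac)⁻¹ *ᵥ f'))|
        ≤ c0R a * Real.exp (-(delta0R d a * bsuppDist n (fineDom n Ωc) f f')) * bl2n f * bl2n f'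
    ∧ |f ⬝ᵥ ((regionOp F e hn a m2 Ωc Ac)⁻¹ *ᵥ ((regionDeriv F e n Ωc Ac ν)ᵀ *ᵥ f'))|
        ≤ c0R a * Real.exp (-(delta0R d a * bsuppDist n (fineDom n Ωc) f f')) * bl2n f * bl2n f'
    ∧ |f ⬝ᵥ (regionDeriv F e n Ωc Ac μ *ᵥ
          ((regionOp F e hn a m2 Ωc Ac)⁻¹ *ᵥ ((regionDeriv F e n Ωc Ac ν)ᵀ *ᵥ f')))|
        ≤ c0R a * Real.exp (-(delta0R d a * bsuppDist n (fineDom n Ωc) f f')) * bl2n f * bl2n f' := by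
  obtain ⟨h0, h1, hct⟩ := delta0R_admissible d ha
  exact cor23_pairings_set_region F hℓ hLip he hn ha hm Ωc hc h17 hsmall h0 h1 hct (bsupp f) (bsupp f')
    (bsuppDist n (fineDom n Ωc) f f') (fun x hx t ht => bsuppDist_le f f' hx ht) f f'
    (fun j hj => eq_zero_of_not_mem_bsupp f j hj) (fun j hj => eq_zero_of_not_mem_bsupp f' j hj) μ ν

omit he hn hm Ωc h17 hsmall in
/-- **B4 COROLLARY 2.3 (2.30), `G_k(Ω,A)` CLAUSE, PRINTED QUANTIFIER SHAPE** — «there exist positive constants c₀, δ₀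
such that …» for «e sufficiently small and … a regular vector field A» (1.7): for a Lipschitz orthogonal flow, `a > 0`,
`c ≥ 0`, `β > 0` THERE EXIST `c₀, δ₀, e₁ > 0` (the explicit `c0R a`, `delta0R d a`, and the `e₁` of
`B4Lower18Regular.threshold_exists`) such that for EVERY charge `0 < e ≤ e₁`, EVERY mesh `η = 1/n`, EVERY finite union
`Ω` of unit blocks, EVERY vector field `A` regular on it in the sense (1.7) `|∂^η_μ A_ν| ≤ c e^{β−1}`, EVERY mass
`m² ≥ 0`, all `R^N`-valued `f, f'` and all directions, the four inequalities (2.30) hold.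
[cite: Balaban1983RegularityDecay, p. 580–581 Corollary 2.3 (2.30); p. 573 (1.7)] -/
theorem cor23_region_exists {β : ℝ} (hβ : 0 < β) :
    ∃ c₀ δ₀ e₁ : ℝ, 0 < c₀ ∧ 0 < δ₀ ∧ 0 < e₁ ∧
      ∀ ⦃e : ℝ⦄, 0 < e → e ≤ e₁ → ∀ ⦃n : ℕ⦄ (hn : 1 ≤ n) (Ωc : Finset (Fin (d + 1) → ℤ))
        (Ac : (Fin (d + 1) → ℤ) → Fin (d + 1) → ℝ),
        (∀ x ∈ fineDom n Ωc, ∀ μ ν : Fin (d + 1), |Ac (x + e1 μ) ν - Ac x ν| ≤ c * e ^ (β - 1) / n) →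
        ∀ ⦃m2 : ℝ⦄, 0 ≤ m2 → ∀ (f f' : ↥(fineDom n Ωc) × ι → ℝ) (μ ν : Fin (d + 1)),
          |f ⬝ᵥ ((regionOp F e hn a m2 Ωc Ac)⁻¹ *ᵥ f')|
              ≤ c₀ * Real.exp (-(δ₀ * bsuppDist n (fineDom n Ωc) f f')) * bl2n f * bl2n f'
          ∧ |f ⬝ᵥ (regionDeriv F e n Ωc Ac μ *ᵥ ((regionOp F e hn a m2 Ωc Ac)⁻¹ *ᵥ f'))|
              ≤ c₀ * Real.exp (-(δ₀ * bsuppDist n (fineDom n Ωc) f f')) * bl2n f * bl2n f'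
          ∧ |f ⬝ᵥ ((regionOp F e hn a m2 Ωc Ac)⁻¹ *ᵥ ((regionDeriv F e n Ωc Ac ν)ᵀ *ᵥ f'))|
              ≤ c₀ * Real.exp (-(δ₀ * bsuppDist n (fineDom n Ωc) f f')) * bl2n f * bl2n f'
          ∧ |f ⬝ᵥ (regionDeriv F e n Ωc Ac μ *ᵥ
                ((regionOp F e hn a m2 Ωc Ac)⁻¹ *ᵥ ((regionDeriv F e n Ωc Ac ν)ᵀ *ᵥ f')))|
              ≤ c₀ * Real.exp (-(δ₀ * bsuppDist n (fineDom n Ωc) f f')) * bl2n f * bl2n f' := by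
  obtain ⟨e₁, he₁, hsm⟩ := threshold_exists ℓ ((d + 1) * c) ha hβ d
  refine ⟨c0R a, delta0R d a, e₁, c0R_pos ha, delta0R_pos d ha, he₁, ?_⟩
  intro e he hle n hn Ωc Ac h17 m2 hm f f' μ ν
  have hsm' : ℓ ^ 2 * ((d + 1) * c * e ^ β) ^ 2 * (d + 1) * (1 + a * (d + 1)) ≤ min 2 a / 4 := by
    have := hsm e he hle
    simpa only [mul_assoc] using this
  exact cor23_main_region F hℓ hLip he hn ha hm Ωc hc h17 hsm' f f' μ ν

end Printed

/-- (2.30) at `A ≠ 0` for the ROTATION FLOW (`N = 2`, `U(t) = ` rotation by `t`, `ℓ = 1`): a hypothesis-free instance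
of the flow assumptions — non-vacuity of `cor23_region_exists`. [cite: Balaban1983RegularityDecay, p. 580 (2.30)] -/
theorem cor23_region_exists_rot {d : ℕ} {a : ℝ} (ha : 0 < a) {c : ℝ} (hc : 0 ≤ c) {β : ℝ} (hβ : 0 < β) :
    ∃ c₀ δ₀ e₁ : ℝ, 0 < c₀ ∧ 0 < δ₀ ∧ 0 < e₁ ∧
      ∀ ⦃e : ℝ⦄, 0 < e → e ≤ e₁ → ∀ ⦃n : ℕ⦄ (hn : 1 ≤ n) (Ωc : Finset (Fin (d + 1) → ℤ))
        (Ac : (Fin (d + 1) → ℤ) → Fin (d + 1) → ℝ),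
        (∀ x ∈ B4Lower18.fineDom n Ωc, ∀ μ ν : Fin (d + 1), |Ac (x + e1 μ) ν - Ac x ν| ≤ c * e ^ (β - 1) / n) →
        ∀ ⦃m2 : ℝ⦄, 0 ≤ m2 → ∀ (f f' : ↥(B4Lower18.fineDom n Ωc) × Fin 2 → ℝ) (μ ν : Fin (d + 1)),
          |f ⬝ᵥ ((B4Lemma21Region.regionOp OrthFlow.rot e hn a m2 Ωc Ac)⁻¹ *ᵥ f')|
              ≤ c₀ * Real.exp (-(δ₀ * bsuppDist n (B4Lower18.fineDom n Ωc) f f')) * bl2n f * bl2n f'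
          ∧ |f ⬝ᵥ (B4Lemma21Region.regionDeriv OrthFlow.rot e n Ωc Ac μ *ᵥ
                ((B4Lemma21Region.regionOp OrthFlow.rot e hn a m2 Ωc Ac)⁻¹ *ᵥ f'))|
              ≤ c₀ * Real.exp (-(δ₀ * bsuppDist n (B4Lower18.fineDom n Ωc) f f')) * bl2n f * bl2n f'
          ∧ |f ⬝ᵥ ((B4Lemma21Region.regionOp OrthFlow.rot e hn a m2 Ωc Ac)⁻¹ *ᵥ
                ((B4Lemma21Region.regionDeriv OrthFlow.rot e n Ωc Ac ν)ᵀ *ᵥ f'))|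
              ≤ c₀ * Real.exp (-(δ₀ * bsuppDist n (B4Lower18.fineDom n Ωc) f f')) * bl2n f * bl2n f'
          ∧ |f ⬝ᵥ (B4Lemma21Region.regionDeriv OrthFlow.rot e n Ωc Ac μ *ᵥ
                ((B4Lemma21Region.regionOp OrthFlow.rot e hn a m2 Ωc Ac)⁻¹ *ᵥ
                  ((B4Lemma21Region.regionDeriv OrthFlow.rot e n Ωc Ac ν)ᵀ *ᵥ f')))|
              ≤ c₀ * Real.exp (-(δ₀ * bsuppDist n (B4Lower18.fineDom n Ωc) f f')) * bl2n f * bl2n f' :=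
  cor23_region_exists (d := d) OrthFlow.rot zero_le_one B4Lower18Regular.rot_lipschitz ha hc hβ

/-- Sanity instance (explicit numbers): at `a = 1` (`min(2,a) = 1`, `σ = 1/4`), `c₀ = 4·17·5 = 340` and, in dimension
`d + 1 = 4`, `δ₀ = 1/80`. -/
example : c0R 1 = 340 ∧ delta0R 3 1 = 1 / 80 := by
  rw [c0R_eq]
  unfold delta0R
  rw [min_eq_right (by norm_num : (1 : ℝ) ≤ 2)]
  norm_num


end

end Literature.MathematicalPhysics.QuantumFieldTheory.Balaban1983to89.B4Cor23Region
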